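/-
Copyright: statement-level skeleton of a published paper (lit-balaban cell, Phase-2 proof seat p39 gen 28). No proof claims
beyond what the kernel checks below.
-/
import Literature.MathematicalPhysics.QuantumFieldTheory.Balaban1983to89.B3Eq122ChargeWick
import Literature.MathematicalPhysics.QuantumFieldTheory.Balaban1983to89.B3Eq123RenormalizationConditions

/-!
# Bałaban, *(Higgs)₂,₃ quantum fields in a finite volume. III*, CMP 88 (1983) [Balaban1983Higgs3], p. 417: THE VACUUM-ENERGY
# COUNTERTERM (1.24) IN THE CHARGE DIRECTION — the term `(e²/2)·∂²/∂e² log∫dA∫dφ e^{−S^ε(A,φ)}∣_{e=λ=0}` of `E₁`, with print's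
# mass counterterm INSERTED in `S^ε`, DERIVED from (1.19)/(1.20) by Wick's theorem (the figure-eight, the theta and the
# counterterm bubble), and the vanishing of all odd orders in `e`

statement-level skeleton of published theorems with citation tags; proofs where landed; nothing here is a claim about the
Yang–Mills mass gap.

[cite: Balaban1983Higgs3, (1.24) p.417 (PDF 7) and the first paragraph of p.418 (PDF 8); (1.19)–(1.22) p.416 (PDF 6); (1.23) p.417;
(1.7), (1.8), (1.10) p.413 (PDF 3)].  Unit `lit-balaban-p39-g28` (Phase-2 proof seat p39, gen 28), free-target protocol G.5-34(d),
ZERO head weight: OPTIONAL LOCATED MEMBER of row **B3.Eq1.24** (and of B3.Eq1.23 / B3.Eq1.19-1.22 for the dictionary §7) of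
`HOME/lit-balaban-r15/ROWS-B3.md` (owner r15; heads `proved`); TAKING `HOME/STATUS.md` 2026-08-24T09:30Z; BRICK 13 of this seat's
series (BRICK 7 `B3Eq122ChargeWick` = the order-`e²` two-point function, IMPORTED — its joint weight `J`, insertions `D1`/`D2`,
majorant, vector covariance and `∫D₂(0)e^{−S_0}F` are the engine here; BRICK 10 `B3Eq123RenormalizationConditions` = the
counterterm inserted as a curve `δm² = ct(e)`, the (2,0) condition; BRICK 12 `B3Eq123IndexZeroTwo` §10 = the `λ`-side of (1.24) at
`e = 0`, orders `λ`, `λ²`).  BRICKS 11–12 are cited BY NAME only (modules unbuilt on the Lean farm at filing time, probe rc 75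
«unbuilt», 2026-08-24T09:2xZ); v1.0–v1.1 also re-derived the six curve/majorant lemmas and the four reflection lemmas of BRICK 10
§1–§4/§13 as PRIVATE copies — v1.2 (gen 32, BRICK 10 built) IMPORTS `B3Eq123RenormalizationConditions` and deletes those copies
(nothing of record is redeclared; the public theorems are new, byte-identical to v1.1).

PDF held: `paper:balaban1983-higgs-2-3-quantum-fields-finite-volume` (journal page = PDF page + 410); p. 417 READ AS AN IMAGE for
this file on the ×2 render `run/shared/lean/pub/pub-balaban/b2b-balaban-ref1/pages/1983-cmp88-higgs23-III/1983-cmp88-higgs23-III-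
p007-x2.png` (2026-08-24T09:27Z); p. 418 (prose only) first from the OCR layer, RE-READ on the `…-p008-x2.png` render
(2026-08-24T10:47Z) for the v1.1 DOCFIX of the quotation below (N-ref1-g107-1 ∕ ref-4 D-g90-1: print says «defined in
(I.1.11)», v1.0 had «(1.20)»).

THE PRINTED TEXT (verbatim).  P. 417: *"Now it is easy to define the vacuum energy counterterm E₁. It is defined by the following
perturbation expansion: E₁ = Σ_{1≤α+β≤n̄} (1/(α!β!)) e^αλ^β (∂^{α+β}/∂e^α∂λ^β log∫dA∫dφ e^{−S^ε(A,φ)})∣_{e=λ=0} (1.24)"*; p. 418: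
*"with n̄ > 12. In S^ε, defined in (I.1.11), we of course have dropped the term E. Terms of this expansion are described by
connected graphs without external legs (vacuum graphs). To renormalize the theory it is sufficient to take the terms in the
expansion (1.24) restricted by the condition 2 ≤ α + 2β ≤ 6; the other terms are convergent as ε → 0."* ((I.1.11) = B1's (1.11)
p. 605: `S^ε` with `m₀² = m² + δm²` and the constant `E`; with `E` dropped it is (1.20) below — so the mass counterterm IS in
`S^ε`.)  P. 416: *"S^ε(A,φ) =
½⟨φ,(−Δ^ε_A + m²)φ⟩ + Σ_{x∈T_ε}ε^d(λ∣φ(x)∣⁴ + ½δm²∣φ(x)∣²) + ½⟨A,(−Δ^ε + μ₀²)A⟩, (1.20)"*; p. 417: *"we write δm² =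
Σ_{2≦α+2β≦4}e^αλ^βδm²_{(α,β)} … The counterterms δm²_{(α,β)} are defined by the equations −δm²_{(α,β)} + Σ_{x∈T_ε}ε^dΣ^ε_{(α,β)}(x) =
0. … δm² = −4(N+2)λC^ε_0(0) + e²dC^ε(0)q² + … − e²Σ_{x′∈T_ε}ε^dΣ_{μ=1}^d q(∂^ε_μC^ε_0∂^{ε*}_μ)(x−x′)qC^ε(x−x′) + … (1.23)"* (the terms
②, ④ of p26's `B3Eq123Counterterms`: `sig2`/`ct2`, `sig4`/`ct4`).

WHAT WAS IN THE TREE BEFORE.  (1.24) is TYPED with body (r01 `B1Sect1Statements.ModelData.e1R`, named `B3Sect1TwoPoint.E1of124R`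
by r15: the Taylor sum of `log Z` with right `λ`-derivatives; the typer's bridges to r12's (I.3.62)).  DERIVED from the measure so
far: the `λ`-side at `e = 0` — BRICK 12 §10 (`hasDerivWithinAt_logZct`, `iteratedDerivWithin_two_logZct`,
`vacuum_secondOrder_at_dm2One`: the orders `λ`, `λ²` of `log Z` with `λδm²_{(0,1)} + λ²δm²_{(0,2)}` inserted).  NOT in the tree:
any term of (1.24) with `α ≥ 1`, i.e. the vacuum graphs with vector lines.  This file derives the `e`-direction at `λ = 0`: the
order `e²` — print's index `(2,0)`, inside the range `2 ≤ α+2β ≤ 6` that *"it is sufficient to take"* — evaluated in closed form,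
and all odd orders `(2k+1, 0)`.

WHICH COEFFICIENT OF (1.24) THIS IS (owner r15's ask, 2026-08-24T09:33Z).  Print defines `E₁` by (1.24) with the mass
counterterm `δm²` INSIDE `S^ε` ((1.20); p. 418 drops only `E`).  The body of record of row B3.Eq1.24 is r01's
`B1Sect1Statements.ModelData.e1R` = r15's `B3Sect1TwoPoint.E1of124R` = `Σ_{1≤α+β≤n̄}(α!β!)⁻¹e^αλ^β·∂^α_e∂^β_{λ,+}log Z(e,λ)∣₀` with
the model's counterterm function `δmsq(ε,e,λ)` in the scalar mass.  The value derived in this file,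
`(e²/2)·iteratedDeriv 2 (e ↦ log∫dA dφ J_e(m² + ct(e))) 0`, is THE `(α,β) = (2,0)` TERM OF THAT SUM for the counterterm curve
`ct(e) = δm²(e, λ = 0)` — on BRICK 7's Feynman-gauge carrier; r01's `partitionFn` carrier and BRICK 7's joint weight `J` are NOT
bridged in the tree (BRICK 7 §8 `J_eq_exp_neg_feynmanHiggsAction` reaches r15's typed Feynman-gauge action only), so this is an
identification of READINGS, not a kernel equation between the two carriers.  With print's series (1.23), `ct(e) = δm²_{(2,0)}e² +
δm²_{(3,0)}e³ + δm²_{(4,0)}e⁴` and ONLY `δm²_{(2,0)}` enters (§6 `iteratedDeriv_two_logZ_dm2Of123`).  The `δm² = 0` VARIANT (the same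
derivative for BRICK 7's weight at the fixed mass `m²`) is §6 `iteratedDeriv_two_logZ_noCounterterm`; the two DIFFER EXACTLY BY
THE COUNTERTERM BUBBLE `−δm²_{(2,0)}·N·Σ_xη^dC₀(x,x)` (§6 `iteratedDeriv_two_logZ_quadratic_sub_noCounterterm`) — the `e`-direction
analogue of «BRICK 12 §10 (with `λδm²_{(0,1)} + λ²δm²_{(0,2)}` inserted) versus BRICK 1 `B3Eq122FirstOrderWick` §13 (`δm² = 0`)» on
the `λ`-side.

THE SETTING = BRICK 7's (`B3Eq122ChargeWick` §0–§4): the model torus `T^{(j)}_η` of `B3WT223Instance` (print's `T_ε`, `η = ε`,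
volume element `w = η^d`, difference quotient `c = η⁻¹`), scalar fields `φ : T → ℝ^N`, the vector field in components
`A : T → ℝ^d` with the Feynman-gauge Gaussian `W_A = e^{−½⟨A,(−Δ^η+μ₀²)A⟩}` (B1 (1.11)), the charge `e` a VARIABLE entering through
`U(ηeA_b) = exp(ηeA_b·q)` (`q` the model's antisymmetric charge matrix), the joint weight `J_e(M) = W_A·e^{−½⟨φ,(−Δ^η_{A,e}+M)φ⟩}` at
scalar mass `M`.  **The partition function of (1.24)** is `Z^{ct}_e := ∫dA dφ J_e(m² + ct(e))` — (1.20) at `λ = 0` with the mass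
counterterm `δm² = ct(e)` (the term `Σ_xε^d·½δm²∣φ(x)∣²` IS a mass shift, §1) and `E` dropped, as print prescribes; written out as
the integral in every statement (no definition is introduced: theorems only).  Propagators `C₀ = C^η_{m²} = B3WTPropagator.G w c m2`,
`C^ε = C^η_{μ₀²} = G w c μ2` (vector covariance `⟨A_bA_{b′}⟩ = δ_{μ_bμ_{b′}}C^ε(b₋,b′₋)`).  Hypotheses throughout: `η^d > 0`, `m² > 0`,
`μ₀² > 0`; any level `j`, mesh, dimension `d`, number of components `N`; the counterterm curve `ct` is twice differentiable
(everywhere, as the hypotheses `hd`, `hd'` are stated; `ct″` continuous at `0`) with `ct(0) = ct′(0) = 0` (print's `δm²∣_{λ=0} = δm²_{(2,0)}e² + δm²_{(3,0)}e³ + δm²_{(4,0)}e⁴` is such a curve, §6).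

WHAT THIS FILE PROVES (theorems; no definition, no named fact, no `sorry`; standard axioms).
* §1 = BRICK 10 §1–§4 by import (v1.2): the counterterm is a mass shift `J_e(m²+t) = J_e(m²)e^{−½tΣ_xη^d∣φ(x)∣²}`; the
  `e`-derivatives of `J_e(m²+ct(e))` (insertions `D₁ − ½ct′Σ∣φ∣²`, `D₂ − ½ct″Σ∣φ∣² − ct′Σ∣φ∣²D₁ + ¼ct′²(Σ∣φ∣²)²`), their bounds, and
  dominated differentiation under `∫dA dφ` on a ball `∣e∣ < r` where `∣ct∣ ≤ m²/2` (majorant = BRICK 7's product majorant at mass `m²/2`).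
* §2 **`Z^{ct}` AS A FUNCTION OF THE CHARGE**: `hasDerivAt_Z_curve_of_ball` (`Z′(e) = ∫[D₁(e) − ½ct′(e)Σ_xη^d∣φ(x)∣²]e^{−S^ε_e}`),
  `integral_D1_J_curve_zero` (**`Z′(0) = 0`**: one vector leg against the even Gaussian — the order `(1,0)` of (1.24)),
  `hasDerivAt_logZ_curve_of_ball` (`(log Z)′ = Z′/Z`), `hasDerivAt_deriv_logZ_curve_zero_of_ball` and
  **`iteratedDeriv_two_logZ_curve_raw`: `d²/de²∣₀ log Z^{ct} = Z″(0)/Z(0)`, `Z″(0) = ∫[D₂(0) − ½ct″(0)Σ_xη^d∣φ(x)∣²]e^{−S^ε_0}`** —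
  BRICK 7's second insertion (the quartic vertex (1.8)₂,₀+(1.10)₂,₀ in unitarity form plus the square of the cubic one (1.8)₁,₀)
  and the mass-renormalization vertex (1.7) with `δm²_{(2)} = ct″(0)`.
* §3 **WICK'S THEOREM FOR `Z″(0)`** (engines: BRICK 7 `integral_D2_J_zero` at `F = 1` — the `A`-integrals —, this seat's
  `B3WTCovariance.moment2_op` and `B3BilinearWick.integral_bil_bil` — the scalar loops —, `tr q = 0`, `q* = −q`):
  `integral_massForm_J_zero` (the counterterm bubble `⟨Σ_xη^d∣φ(x)∣²⟩ = N·Σ_xη^dC₀(x,x)`), **`integral_D2_J_zero_vacuum`: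
  `∫D₂(0)e^{−S_0} = Z_A·Z₀·tr(q²)·[Σ_bη^dc²η²C^ε(b₋,b₋)C₀(b₋,b₊) + Σ_{b,b′:μ=μ′}(η^dc²η)²C^ε(b₋,b′₋)(C₀(b₋,b′₊)C₀(b₊,b′₋) −
  C₀(b₋,b′₋)C₀(b₊,b′₊))]`** — the FIGURE-EIGHT (the `A`-tadpole `⟨A_b²⟩ = C^ε(b₋,b₋)` of the quartic vertex times the scalar loop
  through the two ends of the bond) and the THETA (two cubic vertices joined by the vector line and by a scalar loop through their
  four legs, in its two non-vanishing pairings; the pairing closing each current on itself has `tr q = 0`), and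
  **`iteratedDeriv_two_logZ_curve`: `d²/de²∣₀ log Z^{ct} = tr(q²)·[figure-eight + theta] − (ct″(0)/2)·N·Σ_xη^dC₀(x,x)`** — the
  three CONNECTED vacuum graphs of order `e²` (*"connected graphs without external legs"*, p. 418); `Z_A·Z₀` cancels against `Z(0)`.
* §4 **ALL ODD ORDERS IN `e` OF (1.24) AT `λ = 0` VANISH** for an even counterterm: `Z_curve_neg_charge` (`Z^{ct}_{−e} = Z^{ct}_e` by
  the reflection `A ↦ −A`, which preserves `dA` and `W_A` and conjugates the charge, `U_{−e}(A) = U_e(−A)`; BRICK 10 §13's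
  lemmas by import), **`iteratedDeriv_odd_logZ_curve`** (`d^{2k+1}/de^{2k+1}∣₀ log Z^{ct} = 0`: the indices `(2k+1, 0)` of `E₁`), and
  `iteratedDeriv_three_logZ_dm2Of123` (print's index **`(3,0)`** with r15's typed series (1.23) inserted at `λ = 0` and
  `δm²_{(3,0)} = 0`, as (1.23) has it).
* §5 **THE PRINT'S FORM** at `cε = 1` (bonds `b = ⟨y, y+εe_μ⟩`; r15's `B3Sect3ScalarSelfEnergy.d1Kernel c μ C₀ = (∂^ε_μC₀)(y,y′)`,
  `dKernel c μ C₀ = (∂^ε_μC₀∂^{ε*}_μ)(y,y′)`): `sq_mul_theta_eq` (**the theta bracket `c²[C₀(y,y′⁺)C₀(y⁺,y′) − C₀(y,y′)C₀(y⁺,y′⁺)] =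
  (∂_μC₀)(y,y′)(∂_μC₀)(y′,y) − C₀(y,y′)(∂_μC₀∂*_μ)(y,y′)`** — the two placements of the vertices' lattice derivatives on the loop:
  one on each line, or both on one line (the ④-pattern of (1.22)) with the other line plain), `sum_G_shift_eq` / `figureEight_split`
  (**the point-splitting of the figure-eight**: the quartic term of `U(ηeA_b)` has its fields at the two ENDS of the bond, so its
  loop is `Σ_μC₀(y,y+εe_μ) = d·C₀(y,y) + εΣ_μ(∂^ε_μC₀)(y,y)` — the (1.8)₂,₀ part, print's ② closed on a loop, and the (1.10)₂,₀
  remnant with one explicit factor `ε`), and **`iteratedDeriv_two_logZ_curve_eq_lattice`**: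
  `d²/de²∣₀ log Z^{ct} = tr(q²)·[Σ_{y,μ}η^dC^ε(y,y)C₀(y,y+εe_μ) + Σ_{y,y′,μ}η^{2d}C^ε(y,y′)((∂_μC₀)(y,y′)(∂_μC₀)(y′,y) −
  C₀(y,y′)(∂_μC₀∂*_μ)(y,y′))] − (ct″(0)/2)·N·Σ_xη^dC₀(x,x)`.
* §6 PRINT'S COUNTERTERMS INSERTED: `iteratedDeriv_two_logZ_quadratic` (`δm² = δe²`: the bubble carries `δ`),
  `iteratedDeriv_two_logZ_noCounterterm` (`δm² = 0`), **`iteratedDeriv_two_logZ_dm2Of123`** (r15's typed `B3Sect1TwoPoint.dm2Of123 e 0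
  ε^d Σ^ε_{(·,·)}` for ANY coefficients: ONLY `δm²_{(2,0)} = dm2Coeff ε^d Σ^ε 2 0` ENTERS the order-`e²` vacuum term — *"we insert
  this into Σ^ε … and we take a sum of terms of order ≦ 4"* read on the vacuum side).
* §7 **THE ORDER-`e²` TERM OF `E₁` WITH PRINT'S `δm²_{(2,0)}`** (`vacuum_secondOrder_at_print_counterterm`): with `e²δm²_{(2,0)} =
  ct2 D + ct4 D` (the solution of print's defining equation at `(2,0)` for the DERIVED self-energy — BRICK 10 `condition_20_iff`;
  here the hypothesis `hδ` at every site, for p26's (1.22)/(1.23)-data `D` carrying these propagators, `D.C0 = C₀`, `D.C = C^ε`,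
  `D.e = e`, `D.w = η^d`, `D.c = c`) and a charge matrix with scalar square (`tr q² = N·q2`, hypothesis `htr`),
  **`(e²/2)·d²/de²∣₀ log Z^ε = ½N·Σ_{y,y′}ε^{2d}·sig4 D(y,y′)·[C₀(y′,y) − C₀(y,y)] + ½N·e²q2·Σ_{y,y′,μ}ε^{2d}C^ε(y,y′)(∂^ε_μC₀)(y,y′)
  (∂^ε_μC₀)(y′,y) + ½N·ε·e²q2·Σ_{y,μ}ε^dC^ε(y,y)(∂^ε_μC₀)(y,y)`**: (i) the theta in its ④-placement — p26's typed ④ `sig4 =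
  −e²Σ_μq²(∂^ε_μC^ε_0∂^{ε*}_μ)C^ε` closed by a scalar line — appears SUBTRACTED AT ZERO MOMENTUM, `C₀(y′,y) − C₀(y,y)`, the
  subtraction being exactly the `ct4`-bubble (p. 417 *"δm² is chosen in such a way that −δm² + Σ^ε is convergent"*); (ii) the
  `C^ε_0(0)`-tadpole of the figure-eight (② `e²dC^ε(0)q²` closed on the loop `C₀(0)`) CANCELS THE `ct2`-BUBBLE IDENTICALLY; (iii)
  the (1.10)₂,₀ point-splitting remnant and (iv) the theta in its `Σ₂`-placement (one derivative on each scalar line, BRICK 7's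
  companion `sgTwo` closed) remain as they are.  Every sign and factor above is the kernel's, not a transcription.
* §8 **THE REMNANT IS A CONTACT TERM**: `latticeEq_diag` (the lattice equation `(−Δ^ε+m²)C^ε_0 = δ^ε` at coinciding points,
  print form `Σ_μ2c²(C₀(y,y) − C₀(y+εe_μ,y)) + m²C₀(y,y) = ε^{−d}`, from this seat's `B3WTPropagator.Ks_mulVec_Gcol` and translation
  invariance `B3WTCovariance.G_transl`), **`sum_d1Kernel_diag`: `Σ_μ(∂^ε_μC₀)(y,y) = (ε/2)(m²C₀(y,y) − ε^{−d})`**,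
  `remnant_eq_contact`; §9 **`vacuum_secondOrder_at_print_counterterm_final`**: §7 with (iii) evaluated,
  `… + ¼N·ε²e²q2·Σ_yε^dC^ε(y,y)(m²C₀(y,y) − ε^{−d})`.

v1.1 (same seat and gen; declarations of v1.0 byte-identical, DOCFIX N-ref1-g107-1 ∕ D-g90-1 in three v1.0 docstrings — the p. 418
quotation «defined in (I.1.11)» and «twice differentiable everywhere» for the global `HasDerivAt` hypotheses — and §10–§14 APPENDED
after v1.0's last declaration `vacuum_secondOrder_at_print_counterterm_final`):
* §10 **EVERY INDEX `(α,β)` OF (1.24) WITH `α` ODD VANISHES, FOR EVERY `β`**: `Z_joint_neg_charge` (the joint partition function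
  `∫dA dφ J_e(m²+ct(e,λ))F(λ,φ)` with ANY weight `F(λ,·)` of the scalar field alone — print's `e^{−λΣ_xε^d∣φ(x)∣⁴}` — and an
  `e`-even counterterm is even in `e` at every `λ`), **`iteratedDeriv_odd_logZ_joint`** (`∂^{2k+1}_e[∂^β_λ log Z^ε]∣_{e=0} = 0`, the
  `λ`-derivatives within any set at any point, e.g. right derivatives at `0⁺` as r01's `e1R` reads (1.24); two-sided twin
  `iteratedDeriv_odd_logZ_joint'`), `index_one_one_logZ_joint` (print's `(1,1)`), `iteratedDeriv_odd_logZ_quartic` (the weight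
  `F = e^{−λΣ_xε^d∣φ(x)∣⁴}` of (1.20) literally, right derivatives at `0⁺`; two-sided twin `…_quartic'`).  So of p. 418's range `2 ≤ α+2β ≤ 6` the indices
  `(3,0)`, `(1,1)`, `(5,0)`, `(3,1)`, `(1,2)` contribute nothing to `E₁`.
* §11 **`E₁` IS EXTENSIVE**: `d1Kernel_transl`, `dKernel_transl` (the lattice derivatives of `C₀` are translation invariant, from
  this seat's `B3WTCovariance.G_transl`/`transl_shift`) and **`iteratedDeriv_two_logZ_curve_eq_card_mul`**: the order-`e²` vacuum
  term is `∣T_ε∣·𝔢(y₀)` with a density `𝔢(y₀)` (the §5 summand at a base point) independent of `y₀` — the sense in which B1's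
  Theorem (`exp(−E₋∣T_ε∣) ≤ Z^ε ≤ exp(E₊∣T_ε∣)`) counts vacuum energies per unit volume; contrast p. 418: only after `C^ε ↦ G^ε_K`
  do the counterterms acquire *"the dependence on x"*.
* §12 `ct2_add_ct4_const`, `print_delta20_eq`, **`exists_print_delta20`**: the hypothesis «`e²δ = ct2 D y + ct4 D y` at every
  site» of §7/§9 is satisfiable, by the explicit `δm²_{(2,0)} = d·C^ε(0)·q2 − Σ_{x′}ε^dΣ_μq2(∂^ε_μC₀∂^{ε*}_μ)(y₀,x′)C^ε(y₀,x′)` — for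
  the torus propagators print's `δm²_{(2,0)}` is a number (p26's `ct2_const`/`ct4_const` assume an abstract `ShiftInv`; here
  unconditional for `D.C0 = C₀`, `D.C = C^ε`).
* §13 `sig4_transl`, **`vacuum_secondOrder_at_print_counterterm_density`**: the RENORMALIZED order-`e²` term of §9 is
  `∣T_ε∣·𝔢₁^{(2,0)}(y₀)` with the explicit density `𝔢₁^{(2,0)}(y₀)` = the §9 summand at a base point (subtracted theta + `Σ₂`-theta
  + contact), the same at every `y₀` — the per-volume normalization (`E_±∣T_ε∣`) in which B1's Theorem (1.14) is stated.
* §14 **`vacuum_secondOrder_explicit`**: THE CARRIER-FREE HEADLINE — print's number `δm²_{(2,0)}` of §12 inserted as the curve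
  `δm²(s) = δm²_{(2,0)}s²`, hypotheses only `η^d > 0`, `m², μ₀² > 0`, `cη = 1`, `w = η^d`, `tr q² = N·q2`:
  `(e²/2)·d²/ds²∣₀ log Z^{ct}_s = ∣T∣·[−½Ne²q2·Σ_{y′,μ}η^{2d}(∂_μC₀∂*_μ)(y₀,y′)C^ε(y₀,y′)(C₀(y′,y₀) − C₀(y₀,y₀))`
  `+ ½Ne²q2·Σ_{y′,μ}η^{2d}C^ε(y₀,y′)(∂_μC₀)(y₀,y′)(∂_μC₀)(y′,y₀) + ¼Nη²e²q2·η^dC^ε(0)(m²C₀(0) − η^{−d})]` (p26's letters eliminated).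

HONEST SCOPE.  (i) `λ = 0` for everything EVALUATED: the index `(2,0)` of (1.24); the vanishing statements (§4, §10) cover all
`(2k+1, β)`; the `β ≥ 1` values are BRICK 12's (`(0,1)`, `(0,2)` at `e = 0`) and nothing is said here about `(2,1)`, `(4,0)`,
`(2,2)`, …, nor about joint smoothness in `(e,λ)` (BRICK 11 `B3Eq119JointSmooth` has it for the two-point function; §10 needs none:
it is pure reflection symmetry in Mathlib's total derivatives).  (ii) Scalar `δm²` as printed
in (1.20): the loops carry `tr q²` while the counterterm bubble carries `N`; §7 is stated under `tr q² = N·q2` (for the models in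
view `q² = −κ²·1`); no claim for a general antisymmetric `q`.  (iii) The three vacuum graphs are EXHIBITED AND IDENTIFIED, not
estimated: nothing is claimed about their size as `ε → 0`, about the sentence *"the other terms are convergent"*, or about print's
(unstated) pictures of the vacuum graphs.  (iv) Finite torus, Feynman gauge (B1 (1.11)), `cη = 1` for §5–§7, as in BRICK 7; the
vacuum-energy constant `E` itself (B1 (1.13)/(I.1.15)) and r01's concrete `logZ` carrier are not touched — the dictionary between
BRICK 7's joint weight and r15's typed Feynman-gauge action is BRICK 7 §8 `J_eq_exp_neg_feynmanHiggsAction` (at `λ = 0`).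
(v) The curve and reflection lemmas of §1/§4 are private re-derivations of BRICK 10's (its olean unbuilt); a later version
may take them from BRICK 10 and delete the copies without touching any public statement.

References: [Balaban1983Higgs3] T. Bałaban, CMP 88 (1983) 411–445, pp. 413, 416–418; [Balaban1982Higgs1] T. Bałaban, CMP 85
(1982) 603–636, (1.4), (1.7), (1.11) pp. 604–605 (lattice fields, `U(A) = exp(qεeA)`, Feynman gauge) as vendored in
`LatticeFieldCalculus`/`HiggsLattice`; [GlimmJaffeQP1987] J. Glimm, A. Jaffe, *Quantum Physics* (2nd ed.), §8.2/§9.1 (Gaussian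
integration by parts — the engine of `B3WTCovariance`/`B3BilinearWick`).
Unit `lit-balaban-p39` gen 28 (literature-prover-lit-balaban-p39-g28-0), HOME `run/shared/lean/pub/lit-balaban/`, 2026-08-24.
v1.2 (gen 32, literature-prover-lit-balaban-p39-g32-0): §1's and §4's private copies of BRICK 10 §1–§4/§13 (≈ 400 lines) →
`import B3Eq123RenormalizationConditions`; four call sites renamed (`…_curve` → `…_massCurve` with `.2`, `mass_pos'` →
`mass_pos_of_abs_le`, `J_neg_charge'` → `J_neg_charge` with BRICK 10's argument order, primes dropped); every public statement
byte-identical to v1.1.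
-/

noncomputable section

open scoped BigOperators InnerProductSpace Topology

namespace Literature.MathematicalPhysics.QuantumFieldTheory.Balaban1983to89.B3Eq124VacuumChargeWick

open _root_.MeasureTheory _root_.Filter
open LatticeFieldCalculus B3WT223Instance B3WTPropagator B3WTCovariance B3WickVertexCalculus B3BilinearWick
  B3Eq122ChargeWick B3Eq123Counterterms B3Sect3ScalarSelfEnergy B3Eq123RenormalizationConditions

variable {P : Params} {j N : ℕ} (C : HiggsLattice.ChargeData N) (η w c m2 μ2 : ℝ)

/-! ## §1 The counterterm `δm² = ct(e)` of (1.20) is a mass shift; the `e`-derivatives of `e^{−S^ε_e}` along the curve, their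
majorants and dominated differentiation under `∫dA dφ` are BRICK 10 `B3Eq123RenormalizationConditions` §1–§4, IMPORTED (v1.2;
v1.0–v1.1 carried private statement-identical copies here while that module was unbuilt on the Lean farm).  Kept: three private
pieces of plumbing that are private in BRICK 10 too. -/

omit C η w c m2 μ2 in
/-- membership in the ball `∣e∣ < r` in metric form. [folklore] -/
private theorem abs_lt_of_mem_ball' {r e : ℝ} (he : e ∈ Metric.ball (0 : ℝ) r) : |e| < r := by
  rwa [Metric.mem_ball, dist_zero_right, Real.norm_eq_abs] at he

omit C η w c m2 μ2 in
/-- the ball `∣e∣ < r` is a neighbourhood of each of its points. [folklore] -/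
private theorem ball_mem_nhds' {r e₀ : ℝ} (he₀ : |e₀| < r) : Metric.ball (0 : ℝ) r ∈ 𝓝 e₀ :=
  Metric.isOpen_ball.mem_nhds (by rwa [Metric.mem_ball, dist_zero_right, Real.norm_eq_abs])

omit C η w c μ2 in
/-- a ball on which the curve is controlled: `ct` twice differentiable, `ct″` continuous at `0`, `ct(0) = 0` ⇒ on some `∣e∣ < r`:
`∣ct∣ ≤ m²/2`, `∣ct′∣ ≤ B`, `∣ct″∣ ≤ B`. [folklore] -/
private theorem exists_ball_bounds' (hm : 0 < m2) {ct ct' ct'' : ℝ → ℝ} (hd : ∀ e, HasDerivAt ct (ct' e) e)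
    (hd' : ∀ e, HasDerivAt ct' (ct'' e) e) (hc'' : ContinuousAt ct'' 0) (h0 : ct 0 = 0) :
    ∃ r B : ℝ, 0 < r ∧ (∀ e, |e| < r → |ct e| ≤ m2 / 2) ∧ (∀ e, |e| < r → |ct' e| ≤ B) ∧
      (∀ e, |e| < r → |ct'' e| ≤ B) := by
  have h1 : ∀ᶠ e in 𝓝 (0:ℝ), dist (ct e) (ct 0) < m2 / 2 :=
    Metric.tendsto_nhds.mp (hd 0).continuousAt (m2 / 2) (half_pos hm)
  have h2 : ∀ᶠ e in 𝓝 (0:ℝ), dist (ct' e) (ct' 0) < 1 := Metric.tendsto_nhds.mp (hd' 0).continuousAt 1 one_pos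
  have h3 : ∀ᶠ e in 𝓝 (0:ℝ), dist (ct'' e) (ct'' 0) < 1 := Metric.tendsto_nhds.mp hc'' 1 one_pos
  obtain ⟨r, hr, hball⟩ := Metric.eventually_nhds_iff.mp (h1.and (h2.and h3))
  have hmem : ∀ e : ℝ, |e| < r → dist e 0 < r := fun e he => by rwa [Real.dist_eq, sub_zero]
  refine ⟨r, max (|ct' 0| + 1) (|ct'' 0| + 1), hr, fun e he => ?_, fun e he => ?_, fun e he => ?_⟩
  · have h := (hball (hmem e he)).1
    rw [Real.dist_eq, h0, sub_zero] at h
    exact h.le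
  · have h := (hball (hmem e he)).2.1
    rw [Real.dist_eq] at h
    have := abs_sub_abs_le_abs_sub (ct' e) (ct' 0)
    exact le_max_of_le_left (by linarith)
  · have h := (hball (hmem e he)).2.2
    rw [Real.dist_eq] at h
    have := abs_sub_abs_le_abs_sub (ct'' e) (ct'' 0)
    exact le_max_of_le_right (by linarith)


/-! ## §2 The partition function `Z^ε_e = ∫dA dφ e^{−S^ε_e(A,φ)}` of (1.24) WITH THE COUNTERTERM `δm² = ct(e)` INSERTED IN THE
ACTION (1.20) (`λ = 0`, `E` dropped as print says), AS A FUNCTION OF THE CHARGE: `Z′(0) = 0`, and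
`d²/de²∣₀ log Z = Z″(0)/Z(0)` with `Z″(0) = ∫[D₂(0) − ½ct″(0)Σ_xη^d∣φ(x)∣²]e^{−S^ε_0}` -/

/-- **`d/de Z^{ct}_e = ∫[D₁(e) − ½ct′(e)Σ_xη^d∣φ(x)∣²]e^{−S^ε_e}` ON THE BALL** `∣e∣ < r` where `∣ct∣ ≤ m²/2`, `∣ct′∣ ≤ B`: the
partition function of (1.24), `Z^{ct}_e = ∫dA dφ e^{−S^ε_e}` with `S^ε_e` = (1.20) at `λ = 0`, `δm² = ct(e)` (BRICK 7's joint weight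
at scalar mass `m² + ct(e)`), differentiated under the integral along the counterterm curve.
[cite: Balaban1983Higgs3, (1.19)–(1.20) p.416, (1.24) p.417] -/
theorem hasDerivAt_Z_curve_of_ball (hw : 0 < w) (hm : 0 < m2) (hμ : 0 < μ2) {ct ct' : ℝ → ℝ} {r B : ℝ}
    (hd : ∀ e, |e| < r → HasDerivAt ct (ct' e) e) (hct : ∀ e, |e| < r → |ct e| ≤ m2 / 2)
    (hct' : ∀ e, |e| < r → |ct' e| ≤ B) {e₀ : ℝ} (he₀ : |e₀| < r) :
    HasDerivAt (fun e => ∫ p : JCfg P j N, J C η w c (m2 + ct e) μ2 e p)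
      (∫ p : JCfg P j N, (D1 C η w c e₀ (toVec p.1) p.2 - 1 / 2 * ct' e₀ * massForm w p.2) *
        J C η w c (m2 + ct e₀) μ2 e₀ p) e₀ := by
  have h := (hasDerivAt_integral_J_massCurve (P := P) (j := j) C η w c m2 μ2 hw hm hμ (ExpGrowth.const (1 : ℝ)) hd hct hct'
    he₀).2
  simp only [mul_one] at h
  exact h

/-- **THE ORDER-`e` TERM OF `Z^{ct}` VANISHES**: at `e = 0` (where `ct = ct′ = 0`) the first-derivative integral is BRICK 7's
`∫D₁(0)e^{−S_0} = 0` — one vector leg against the even free Gaussian. [cite: Balaban1983Higgs3, (1.21) p.416, (1.24) p.417] -/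
theorem integral_D1_J_curve_zero (hw : 0 < w) (hm : 0 < m2) (hμ : 0 < μ2) {ct ct' : ℝ → ℝ} (h0 : ct 0 = 0)
    (h0' : ct' 0 = 0) :
    ∫ p : JCfg P j N, (D1 C η w c 0 (toVec p.1) p.2 - 1 / 2 * ct' 0 * massForm w p.2) *
      J C η w c (m2 + ct 0) μ2 0 p = 0 := by
  have h := integral_D1_J_zero (P := P) (j := j) C η w c m2 μ2 hw hm hμ (ExpGrowth.const (1 : ℝ))
  simp only [mul_one] at h
  simp only [h0, h0', add_zero, mul_zero, zero_mul, sub_zero]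
  exact h

/-- **`d/de log Z^{ct}_e = Z′(e)/Z(e)` ON THE BALL** (`Z > 0`). [cite: Balaban1983Higgs3, (1.24) p.417] -/
theorem hasDerivAt_logZ_curve_of_ball (hw : 0 < w) (hm : 0 < m2) (hμ : 0 < μ2) {ct ct' : ℝ → ℝ} {r B : ℝ}
    (hd : ∀ e, |e| < r → HasDerivAt ct (ct' e) e) (hct : ∀ e, |e| < r → |ct e| ≤ m2 / 2)
    (hct' : ∀ e, |e| < r → |ct' e| ≤ B) {e₀ : ℝ} (he₀ : |e₀| < r) :
    HasDerivAt (fun e => Real.log (∫ p : JCfg P j N, J C η w c (m2 + ct e) μ2 e p))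
      ((∫ p : JCfg P j N, (D1 C η w c e₀ (toVec p.1) p.2 - 1 / 2 * ct' e₀ * massForm w p.2) *
          J C η w c (m2 + ct e₀) μ2 e₀ p) /
        ∫ p : JCfg P j N, J C η w c (m2 + ct e₀) μ2 e₀ p) e₀ :=
  (hasDerivAt_Z_curve_of_ball C η w c m2 μ2 hw hm hμ hd hct hct' he₀).log
    (integral_J_pos C η w c (m2 + ct e₀) μ2 hw (mass_pos_of_abs_le m2 hm (hct e₀ he₀)) hμ e₀).ne'

/-- **THE SECOND DERIVATIVE OF `log Z^{ct}` AT `e = 0` EXISTS**: the quotient `Z′/Z` is differentiable at `0` with derivative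
`Z″(0)/Z(0)` (`Z′(0) = 0`), **`Z″(0) = ∫[D₂(0) − ½ct″(0)Σ_xη^d∣φ(x)∣²]e^{−S^ε_0}`** — BRICK 7's second insertion `D₂(0)` (the
quartic vertex (1.8)₂,₀+(1.10)₂,₀ and the square of the cubic one) plus the mass-renormalization vertex (1.7) `−½δm²_{(2)}Σ_xε^d∣φ(x)∣²`,
`δm²_{(2)} = ct″(0)`. [cite: Balaban1983Higgs3, (1.7) p.413, (1.19)–(1.21) p.416, (1.24) p.417] -/
theorem hasDerivAt_deriv_logZ_curve_zero_of_ball (hw : 0 < w) (hm : 0 < m2) (hμ : 0 < μ2) {ct ct' ct'' : ℝ → ℝ}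
    {r B : ℝ} (hr : 0 < r) (hd : ∀ e, |e| < r → HasDerivAt ct (ct' e) e)
    (hd' : ∀ e, |e| < r → HasDerivAt ct' (ct'' e) e) (hct : ∀ e, |e| < r → |ct e| ≤ m2 / 2)
    (hct' : ∀ e, |e| < r → |ct' e| ≤ B) (hct'' : ∀ e, |e| < r → |ct'' e| ≤ B) (h0 : ct 0 = 0) (h0' : ct' 0 = 0) :
    HasDerivAt (fun e =>
      (∫ p : JCfg P j N, (D1 C η w c e (toVec p.1) p.2 - 1 / 2 * ct' e * massForm w p.2) *
          J C η w c (m2 + ct e) μ2 e p) /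
        ∫ p : JCfg P j N, J C η w c (m2 + ct e) μ2 e p)
      ((∫ p : JCfg P j N, (D2 C η w c 0 (toVec p.1) p.2 - 1 / 2 * ct'' 0 * massForm w p.2) * J C η w c m2 μ2 0 p) /
        ∫ p : JCfg P j N, J C η w c m2 μ2 0 p) 0 := by
  have h00 : |(0 : ℝ)| < r := by rwa [abs_zero]
  have hZ := hasDerivAt_Z_curve_of_ball (P := P) (j := j) C η w c m2 μ2 hw hm hμ hd hct hct' h00
  have hZ' := (hasDerivAt_integral_D1_J_massCurve (P := P) (j := j) C η w c m2 μ2 hw hm hμ (ExpGrowth.const (1 : ℝ))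
    hd hd' hct hct' hct'' h00).2
  simp only [mul_one] at hZ'
  have hZ0 : (∫ p : JCfg P j N, J C η w c (m2 + ct 0) μ2 0 p) ≠ 0 :=
    (integral_J_pos C η w c (m2 + ct 0) μ2 hw (mass_pos_of_abs_le m2 hm (hct 0 h00)) hμ 0).ne'
  have h := hZ'.div hZ hZ0
  refine h.congr_deriv ?_
  rw [integral_D1_J_curve_zero C η w c m2 μ2 hw hm hμ h0 h0']
  simp only [h0, h0', add_zero, mul_zero, zero_mul, sub_zero, ne_eq, OfNat.ofNat_ne_zero, not_false_eq_true,
    zero_pow]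
  -- freeze the integrals
  set Z2 : ℝ := ∫ p : JCfg P j N, (D2 C η w c 0 (toVec p.1) p.2 - 1 / 2 * ct'' 0 * massForm w p.2) *
    J C η w c m2 μ2 0 p with hZ2
  set Z0 : ℝ := ∫ p : JCfg P j N, J C η w c m2 μ2 0 p with hZ0
  have hZ00 : Z0 ≠ 0 := (integral_J_pos C η w c m2 μ2 hw hm hμ 0).ne'
  field_simp

/-- **`d²/de²∣₀ log Z^{ct} = Z″(0)/Z(0)` in Mathlib's `iteratedDeriv`**, for every counterterm curve twice differentiable
(everywhere; `ct″` continuous at `0`) with `ct(0) = ct′(0) = 0` (print's `δm² = Σ_{2≤α≤4}e^αδm²_{(α,0)}` at `λ = 0` is such a curve):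
`iteratedDeriv 2 (log Z^{ct}) 0 = ∫[D₂(0) − ½ct″(0)Σ_xη^d∣φ(x)∣²]e^{−S^ε_0} / ∫e^{−S^ε_0}`.
[cite: Balaban1983Higgs3, (1.19)–(1.21) p.416, (1.24) p.417] -/
theorem iteratedDeriv_two_logZ_curve_raw (hw : 0 < w) (hm : 0 < m2) (hμ : 0 < μ2) {ct ct' ct'' : ℝ → ℝ}
    (hd : ∀ e, HasDerivAt ct (ct' e) e) (hd' : ∀ e, HasDerivAt ct' (ct'' e) e) (hc'' : ContinuousAt ct'' 0)
    (h0 : ct 0 = 0) (h0' : ct' 0 = 0) :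
    iteratedDeriv 2 (fun e => Real.log (∫ p : JCfg P j N, J C η w c (m2 + ct e) μ2 e p)) 0 =
      (∫ p : JCfg P j N, (D2 C η w c 0 (toVec p.1) p.2 - 1 / 2 * ct'' 0 * massForm w p.2) * J C η w c m2 μ2 0 p) /
        ∫ p : JCfg P j N, J C η w c m2 μ2 0 p := by
  obtain ⟨r, B, hr, hct, hct', hct''⟩ := exists_ball_bounds' m2 hm hd hd' hc'' h0
  have hdr : ∀ e, |e| < r → HasDerivAt ct (ct' e) e := fun e _ => hd e
  have hdr' : ∀ e, |e| < r → HasDerivAt ct' (ct'' e) e := fun e _ => hd' e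
  have h00 : |(0 : ℝ)| < r := by rwa [abs_zero]
  have hev : deriv (fun e => Real.log (∫ p : JCfg P j N, J C η w c (m2 + ct e) μ2 e p)) =ᶠ[𝓝 0] fun e =>
      (∫ p : JCfg P j N, (D1 C η w c e (toVec p.1) p.2 - 1 / 2 * ct' e * massForm w p.2) *
          J C η w c (m2 + ct e) μ2 e p) /
        ∫ p : JCfg P j N, J C η w c (m2 + ct e) μ2 e p :=
    Filter.eventually_of_mem (ball_mem_nhds' h00) fun e he =>
      (hasDerivAt_logZ_curve_of_ball C η w c m2 μ2 hw hm hμ hdr hct hct' (abs_lt_of_mem_ball' he)).deriv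
  rw [iteratedDeriv_succ, iteratedDeriv_one, hev.deriv_eq]
  exact (hasDerivAt_deriv_logZ_curve_zero_of_ball C η w c m2 μ2 hw hm hμ hr hdr hdr' hct hct' hct'' h0 h0').deriv


/-! ## §3 Wick's theorem for `Z″(0)`: the vacuum graphs of order `e²` — the figure-eight (the quartic vertex
(1.8)₂,₀+(1.10)₂,₀ closed on itself: an `A`-tadpole times a scalar loop), the theta (two cubic vertices (1.8)₁,₀: a scalar
loop with one vector chord) — and the counterterm bubble (the mass vertex (1.7) closed on itself) -/

section Wick

omit C η w c m2 μ2 in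
/-- `tr(−X) = −tr X`. [folklore] -/
private theorem trE_neg (X : EuclideanSpace ℝ (Fin N) →L[ℝ] EuclideanSpace ℝ (Fin N)) : trE (-X) = -trE X := by
  unfold trE
  rw [← Finset.sum_neg_distrib]
  refine Finset.sum_congr rfl fun i _ => ?_
  rw [← inner_neg_right]
  rfl

omit C η w c m2 μ2 in
/-- `tr 1 = N` (the `N` scalar components running around a loop). [folklore] -/
private theorem trE_one : trE (1 : EuclideanSpace ℝ (Fin N) →L[ℝ] EuclideanSpace ℝ (Fin N)) = N := by
  unfold trE
  simp only [one_apply_eq_self, (EuclideanSpace.basisFun (Fin N) ℝ).orthonormal.1, real_inner_self_eq_norm_sq,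
    one_pow, Finset.sum_const, Finset.card_univ, Fintype.card_fin, nsmul_eq_mul, mul_one]

omit η w c m2 μ2 in
/-- `q*q = −q²` (`q* = −q`). [cite: Balaban1982Higgs1, (1.7) p.605] -/
private theorem adjoint_comp_q : (ContinuousLinearMap.adjoint C.q).comp C.q = -(C.q.comp C.q) := by
  rw [adjoint_q, ContinuousLinearMap.neg_comp]

omit η w c m2 μ2 in
/-- `q*q* = q²`. [cite: Balaban1982Higgs1, (1.7) p.605] -/
private theorem adjoint_comp_adjoint_q :
    (ContinuousLinearMap.adjoint C.q).comp (ContinuousLinearMap.adjoint C.q) = C.q.comp C.q := by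
  rw [adjoint_q, ContinuousLinearMap.neg_comp, ContinuousLinearMap.comp_neg, neg_neg]

omit μ2 in
/-- **THE COUNTERTERM BUBBLE**: `∫W₀·Σ_xη^d∣φ(x)∣² = Z₀·N·Σ_xη^dC₀(x,x)` — the mass vertex (1.7) closed on itself, a scalar loop
`C₀(x,x)` with `N` components (`W₀ = e^{−½⟨φ,(−Δ^η_0+m²)φ⟩}`, `Z₀ = ∫W₀`). [cite: Balaban1983Higgs3, (1.7) p.413, (1.24) p.417] -/
private theorem integral_W0_massForm (hw : 0 < w) (hm : 0 < m2) :
    ∫ φ : Cfg P j N, weight C η w c m2 (0 : VecField P j ℝ) φ * massForm w φ =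
      (∫ φ : Cfg P j N, weight C η w c m2 (0 : VecField P j ℝ) φ) * ((N : ℝ) * ∑ x : Site P j, w * G w c m2 x x) := by
  have hq : ∀ (φ : Cfg P j N) (x : Site P j),
      ‖φ x‖ ^ 2 = ⟪φ x, (1 : EuclideanSpace ℝ (Fin N) →L[ℝ] EuclideanSpace ℝ (Fin N)) (φ x)⟫_ℝ := fun φ x => by
    rw [one_apply_eq_self, real_inner_self_eq_norm_sq]
  have hint : ∀ x : Site P j, Integrable (fun φ : Cfg P j N => weight C η w c m2 (0 : VecField P j ℝ) φ *
      ⟪φ x, (1 : EuclideanSpace ℝ (Fin N) →L[ℝ] EuclideanSpace ℝ (Fin N)) (φ x)⟫_ℝ) := fun x =>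
    ExpGrowth.integrable C η w c m2 hw hm (ExpGrowth.inner_op_apply x x _)
  unfold massForm
  simp_rw [hq, Finset.mul_sum]
  have hre : ∀ φ : Cfg P j N, (∑ x : Site P j, weight C η w c m2 (0 : VecField P j ℝ) φ *
      (w * ⟪φ x, (1 : EuclideanSpace ℝ (Fin N) →L[ℝ] EuclideanSpace ℝ (Fin N)) (φ x)⟫_ℝ)) =
      ∑ x : Site P j, w * (weight C η w c m2 (0 : VecField P j ℝ) φ *
        ⟪φ x, (1 : EuclideanSpace ℝ (Fin N) →L[ℝ] EuclideanSpace ℝ (Fin N)) (φ x)⟫_ℝ) := fun φ =>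
    Finset.sum_congr rfl fun x _ => by ring
  simp_rw [hre]
  rw [integral_finsetSum _ fun x _ => (hint x).const_mul w]
  simp_rw [integral_const_mul, moment2_op C η w c m2 hw hm, trE_one]
  exact Finset.sum_congr rfl fun x _ => by ring

/-- `Z(0) = Z_A·Z₀`: at `e = 0` (and `ct(0) = 0`) the partition function is the product of the two free ones.
[cite: Balaban1983Higgs3, (1.20) p.416] -/
theorem integral_J_zero_eq (e : ℝ) (he : e = 0) :
    ∫ p : JCfg P j N, J C η w c m2 μ2 e p =
      (∫ A : Cfg P j P.d, WA η w c μ2 A) * ∫ φ : Cfg P j N, weight C η w c m2 (0 : VecField P j ℝ) φ := by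
  subst he
  have h := integral_prod_WA_W0 (P := P) (j := j) C η w c m2 μ2 (fun _ => (1 : ℝ)) (fun _ => (1 : ℝ))
  simp only [mul_one] at h
  simp_rw [J_zero]
  exact h

/-- **THE COUNTERTERM BUBBLE AGAINST THE JOINT MEASURE**: `∫dA dφ e^{−S_0}Σ_xη^d∣φ(x)∣² = Z_A·Z₀·N·Σ_xη^dC₀(x,x)`.
[cite: Balaban1983Higgs3, (1.7) p.413, (1.24) p.417] -/
theorem integral_massForm_J_zero (hw : 0 < w) (hm : 0 < m2) :
    ∫ p : JCfg P j N, massForm w p.2 * J C η w c m2 μ2 0 p =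
      (∫ A : Cfg P j P.d, WA η w c μ2 A) *
        ((∫ φ : Cfg P j N, weight C η w c m2 (0 : VecField P j ℝ) φ) * ((N : ℝ) * ∑ x : Site P j, w * G w c m2 x x)) := by
  have h := integral_prod_WA_W0 (P := P) (j := j) C η w c m2 μ2 (fun _ => (1 : ℝ)) (fun φ => massForm w φ)
  simp only [mul_one] at h
  rw [← integral_W0_massForm C η w c m2 hw hm, ← h]
  refine integral_congr_ae (Filter.Eventually.of_forall fun p => ?_)
  simp only [J_zero]
  ring

/-- **`Z″(0)` AT `δm² = 0` BY WICK'S THEOREM — THE TWO VACUUM GRAPHS OF ORDER `e²`.**  BRICK 7's `∫D₂(0)e^{−S_0}F` at `F = 1`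
with the scalar Gaussian integrals done (`moment2_op`, `integral_bil_bil`; `tr q = 0`, `q* = −q`):
`∫D₂(0)e^{−S_0} = Z_A·Z₀·tr(q²)·[Σ_bη^dc²η²·C^ε(b₋,b₋)·C₀(b₋,b₊) + Σ_{b,b′:μ=μ′}(η^dc²η)²C^ε(b₋,b′₋)·(C₀(b₋,b′₊)C₀(b₊,b′₋) −
C₀(b₋,b′₋)C₀(b₊,b′₊))]` — the FIGURE-EIGHT (the `A`-tadpole `⟨A_b²⟩ = C^ε(b₋,b₋)` of the quartic vertex `½(ηeA_b)²⟪φ(b₋),q²φ(b₊)⟫`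
times the scalar loop through the two ends of the bond) and the THETA (the two cubic vertices `ηeA_b⟪φ(b₋),qφ(b₊)⟫` joined by the
vector line `⟨A_bA_{b′}⟩ = δ_{μμ′}C^ε(b₋,b′₋)` and by a scalar loop through their four legs, in its two pairings; the third pairing —
each current closing on itself — has `tr q = 0`). [cite: Balaban1983Higgs3, (1.8), (1.10) p.413, (1.20)–(1.21) p.416, (1.24) p.417] -/
theorem integral_D2_J_zero_vacuum (hw : 0 < w) (hm : 0 < m2) (hμ : 0 < μ2) :
    ∫ p : JCfg P j N, D2 C η w c 0 (toVec p.1) p.2 * J C η w c m2 μ2 0 p =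
      (∫ A : Cfg P j P.d, WA η w c μ2 A) * ((∫ φ : Cfg P j N, weight C η w c m2 (0 : VecField P j ℝ) φ) *
        (trE (C.q.comp C.q) *
          ((∑ b : PBond P j, w * (c ^ 2 * η ^ 2) * G w c μ2 b.src b.src * G w c m2 b.src b.tgt)
            + ∑ b : PBond P j, ∑ b' : PBond P j, (w * (c ^ 2 * η)) * (w * (c ^ 2 * η)) *
                (G w c μ2 b.src b'.src * if b.dir = b'.dir then 1 else 0) *
                  (G w c m2 b.src b'.tgt * G w c m2 b.tgt b'.src - G w c m2 b.src b'.src * G w c m2 b.tgt b'.tgt)))) := by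
  have h := integral_D2_J_zero (P := P) (j := j) C η w c m2 μ2 hw hm hμ (ExpGrowth.const (1 : ℝ))
  simp only [mul_one] at h
  rw [h]
  have h1 : ∀ b : PBond P j, ∫ φ : Cfg P j N, weight C η w c m2 (0 : VecField P j ℝ) φ *
      ⟪φ b.src, C.q (C.q (φ b.tgt))⟫_ℝ = (∫ φ : Cfg P j N, weight C η w c m2 (0 : VecField P j ℝ) φ) *
        (G w c m2 b.src b.tgt * trE (C.q.comp C.q)) := fun b =>
    moment2_op C η w c m2 hw hm b.src b.tgt (C.q.comp C.q)
  have h2 : ∀ b b' : PBond P j, ∫ φ : Cfg P j N, weight C η w c m2 (0 : VecField P j ℝ) φ *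
      (⟪φ b.src, C.q (φ b.tgt)⟫_ℝ * ⟪φ b'.src, C.q (φ b'.tgt)⟫_ℝ) =
        (∫ φ : Cfg P j N, weight C η w c m2 (0 : VecField P j ℝ) φ) * (trE (C.q.comp C.q) *
          (G w c m2 b.src b'.tgt * G w c m2 b.tgt b'.src - G w c m2 b.src b'.src * G w c m2 b.tgt b'.tgt)) := by
    intro b b'
    rw [integral_bil_bil C η w c m2 hw hm b.src b.tgt b'.src b'.tgt C.q C.q, adjoint_comp_q, adjoint_comp_adjoint_q, trE_neg,
      B3WT226FreeGaussian.trE_q C]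
    ring
  simp_rw [h1, h2]
  simp only [Finset.mul_sum, mul_add]
  congr 1
  · exact Finset.sum_congr rfl fun b _ => by ring
  · exact Finset.sum_congr rfl fun b _ => Finset.sum_congr rfl fun b' _ => by ring

/-- **`d²/de²∣₀ log Z^{ct}` EVALUATED** (counterterm twice differentiable everywhere, `ct″` continuous at `0`,
`ct(0) = ct′(0) = 0`; `Z_A·Z₀` cancels against `Z(0)`):
`d²/de²∣₀ log∫dA dφ e^{−S^ε_e} = tr(q²)·[Σ_bη^dc²η²C^ε(b₋,b₋)C₀(b₋,b₊) + Σ_{b,b′:μ=μ′}(η^dc²η)²C^ε(b₋,b′₋)(C₀(b₋,b′₊)C₀(b₊,b′₋) −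
C₀(b₋,b′₋)C₀(b₊,b′₊))] − (ct″(0)/2)·N·Σ_xη^dC₀(x,x)` — figure-eight + theta − counterterm bubble: the three CONNECTED vacuum graphs
of order `e²` of the expansion (1.24) (*"Terms of this expansion are described by connected graphs without external legs (vacuum
graphs)"*, p. 418). [cite: Balaban1983Higgs3, (1.24) p.417, p.418] -/
theorem iteratedDeriv_two_logZ_curve (hw : 0 < w) (hm : 0 < m2) (hμ : 0 < μ2) {ct ct' ct'' : ℝ → ℝ}
    (hd : ∀ e, HasDerivAt ct (ct' e) e) (hd' : ∀ e, HasDerivAt ct' (ct'' e) e) (hc'' : ContinuousAt ct'' 0)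
    (h0 : ct 0 = 0) (h0' : ct' 0 = 0) :
    iteratedDeriv 2 (fun e => Real.log (∫ p : JCfg P j N, J C η w c (m2 + ct e) μ2 e p)) 0 =
      trE (C.q.comp C.q) *
          ((∑ b : PBond P j, w * (c ^ 2 * η ^ 2) * G w c μ2 b.src b.src * G w c m2 b.src b.tgt)
            + ∑ b : PBond P j, ∑ b' : PBond P j, (w * (c ^ 2 * η)) * (w * (c ^ 2 * η)) *
                (G w c μ2 b.src b'.src * if b.dir = b'.dir then 1 else 0) *
                  (G w c m2 b.src b'.tgt * G w c m2 b.tgt b'.src - G w c m2 b.src b'.src * G w c m2 b.tgt b'.tgt))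
        - ct'' 0 / 2 * ((N : ℝ) * ∑ x : Site P j, w * G w c m2 x x) := by
  rw [iteratedDeriv_two_logZ_curve_raw C η w c m2 μ2 hw hm hμ hd hd' hc'' h0 h0']
  have hI1 : Integrable (fun p : JCfg P j N => D2 C η w c 0 (toVec p.1) p.2 * J C η w c m2 μ2 0 p) := by
    have h := (hasDerivAt_integral_D1_J_mul (P := P) (j := j) C η w c m2 μ2 hw hm hμ (ExpGrowth.const (1 : ℝ)) 0).1
    simp only [mul_one] at h
    exact h
  have hI2 : Integrable (fun p : JCfg P j N => massForm w p.2 * J C η w c m2 μ2 0 p) := by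
    have h := integrable_J_mul (P := P) (j := j) C η w c m2 μ2 hw hm hμ (expGrowth_massForm (P := P) (j := j) (N := N) w) 0
    exact h.congr (Filter.Eventually.of_forall fun p => by simp only; ring)
  have hsplit : (∫ p : JCfg P j N, (D2 C η w c 0 (toVec p.1) p.2 - 1 / 2 * ct'' 0 * massForm w p.2) * J C η w c m2 μ2 0 p) =
      (∫ p : JCfg P j N, D2 C η w c 0 (toVec p.1) p.2 * J C η w c m2 μ2 0 p)
        - 1 / 2 * ct'' 0 * ∫ p : JCfg P j N, massForm w p.2 * J C η w c m2 μ2 0 p := by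
    rw [← integral_const_mul, ← integral_sub hI1 (hI2.const_mul _)]
    refine integral_congr_ae (Filter.Eventually.of_forall fun p => ?_)
    simp only
    ring
  rw [hsplit, integral_D2_J_zero_vacuum C η w c m2 μ2 hw hm hμ, integral_massForm_J_zero C η w c m2 μ2 hw hm,
    integral_J_zero_eq C η w c m2 μ2 0 rfl]
  have hZA : (∫ A : Cfg P j P.d, WA η w c μ2 A) ≠ 0 := (ZA_pos η w c μ2 hw hμ).ne'
  have hZ0 : (∫ φ : Cfg P j N, weight C η w c m2 (0 : VecField P j ℝ) φ) ≠ 0 :=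
    (B3WT226Traces.Z_pos C η w c m2 hw hm).ne'
  field_simp

end Wick


/-! ## §4 THE ODD ORDERS IN `e` OF (1.24) VANISH: charge conjugation `A ↦ −A` on the partition function (BRICK 10 §13's
reflection lemmas `toVec_neg`, `weight_Ce_neg`, `WA_neg`, `J_neg_charge` are IMPORTED since v1.2 — v1.0–v1.1 carried private
copies; kept private here: the measure-preserving reflection and the parity-of-derivatives plumbing, private in BRICK 10 too, and
`integral_J_neg_charge_one` = BRICK 10's `integral_J_neg_charge` at `F = 1`) -/

section Parity

omit C η w c m2 μ2 in
/-- the reflection `A ↦ −A` preserves `dA` (sitewise `−1 ∈ O(d)`). [folklore] -/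
private theorem measurePreserving_negVec' :
    MeasurePreserving (fun A : Cfg P j P.d => -A) volume volume :=
  volume_preserving_pi (α' := fun _ : Site P j => EuclideanSpace ℝ (Fin P.d))
    (β' := fun _ : Site P j => EuclideanSpace ℝ (Fin P.d)) (f := fun _ v => -v)
    fun _ => (LinearIsometryEquiv.neg ℝ (E := EuclideanSpace ℝ (Fin P.d))).measurePreserving

omit C η w c m2 μ2 in
/-- `∫dA dφ g(−A,φ) = ∫dA dφ g(A,φ)`. [folklore] -/
private theorem integral_comp_negVec' (g : JCfg P j N → ℝ) :
    ∫ p : JCfg P j N, g (-p.1, p.2) = ∫ p : JCfg P j N, g p := by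
  have he : MeasurePreserving
      ((MeasurableEquiv.neg (Cfg P j P.d)).prodCongr (MeasurableEquiv.refl (Cfg P j N)))
      (volume : Measure (JCfg P j N)) (volume : Measure (JCfg P j N)) :=
    (measurePreserving_negVec' (P := P) (j := j)).prod (MeasurePreserving.id (volume : Measure (Cfg P j N)))
  exact he.integral_comp' g

omit m2 in
/-- charge conjugation on the partition function at a fixed scalar mass: `∫dA dφ e^{−S^ε_{−e}} = ∫dA dφ e^{−S^ε_e}`.
[cite: Balaban1983Higgs3, (1.19)–(1.20) p.416] -/
private theorem integral_J_neg_charge_one (M e : ℝ) :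
    ∫ p : JCfg P j N, J C η w c M μ2 (-e) p = ∫ p : JCfg P j N, J C η w c M μ2 e p := by
  simp_rw [J_neg_charge C η w c M μ2 e]
  exact integral_comp_negVec' (fun p => J C η w c M μ2 e p)

/-- **THE PARTITION FUNCTION OF (1.24) WITH AN EVEN COUNTERTERM IS EVEN IN THE CHARGE**: for `δm² = ct(e)` with `ct(−e) = ct(e)`,
`Z^{ct}_{−e} = Z^{ct}_e` — substitute `A ↦ −A` (it preserves `dA` and the vector-field Gaussian of (1.20), and `U_{−e}(A) = U_e(−A)`).
[cite: Balaban1983Higgs3, (1.19)–(1.20) p.416, (1.24) p.417] -/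
theorem Z_curve_neg_charge {ct : ℝ → ℝ} (hct : ∀ e, ct (-e) = ct e) (e : ℝ) :
    ∫ p : JCfg P j N, J C η w c (m2 + ct (-e)) μ2 (-e) p = ∫ p : JCfg P j N, J C η w c (m2 + ct e) μ2 e p := by
  rw [hct]
  exact integral_J_neg_charge_one C η w c μ2 (m2 + ct e) e

omit C η w c m2 μ2 in
/-- the derivative of an even function is odd (Mathlib's total `deriv`). [folklore] -/
private theorem deriv_neg_of_even' {f : ℝ → ℝ} (hf : ∀ s, f (-s) = f s) (s : ℝ) : deriv f (-s) = -deriv f s := by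
  have h := deriv_comp_neg f s
  have hfe : (fun x => f (-x)) = f := funext hf
  rw [hfe] at h
  linarith

omit C η w c m2 μ2 in
/-- the derivative of an odd function is even. [folklore] -/
private theorem deriv_neg_of_odd' {g : ℝ → ℝ} (hg : ∀ s, g (-s) = -g s) (s : ℝ) : deriv g (-s) = deriv g s := by
  have h := deriv_comp_neg g s
  have hge : (fun x => g (-x)) = -g := funext hg
  rw [hge, deriv.neg] at h
  linarith

omit C η w c m2 μ2 in
/-- the even-order derivatives of an even function are even. [folklore] -/
private theorem iteratedDeriv_even_of_even' {f : ℝ → ℝ} (hf : ∀ s, f (-s) = f s) (k : ℕ) (s : ℝ) :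
    iteratedDeriv (2 * k) f (-s) = iteratedDeriv (2 * k) f s := by
  induction k generalizing s with
  | zero => simpa using hf s
  | succ k ih =>
    have h2 : 2 * (k + 1) = 2 * k + 1 + 1 := by ring
    rw [h2, iteratedDeriv_succ, iteratedDeriv_succ]
    exact deriv_neg_of_odd' (deriv_neg_of_even' ih) s

omit C η w c m2 μ2 in
/-- the odd-order derivatives of an even function vanish at `0`. [folklore] -/
private theorem iteratedDeriv_odd_eq_zero_of_even' {f : ℝ → ℝ} (hf : ∀ s, f (-s) = f s) (k : ℕ) :
    iteratedDeriv (2 * k + 1) f 0 = 0 := by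
  rw [iteratedDeriv_succ]
  have h := deriv_neg_of_even' (iteratedDeriv_even_of_even' hf k) 0
  rw [neg_zero] at h
  linarith

/-- **ALL ODD ORDERS IN `e` OF THE EXPANSION (1.24) AT `λ = 0` VANISH** for an even counterterm `ct(−e) = ct(e)`:
`d^{2k+1}/de^{2k+1}∣₀ log∫dA dφ e^{−S^ε_e} = 0` — the terms `(α,0)` of `E₁` with `α` odd are zero; in particular `(1,0)` and, at
weight 3, **`(3,0)`** (with (1.23)'s `δm²_{(3,0)} = 0` the inserted `δm² = δm²_{(2,0)}e² + δm²_{(4,0)}e⁴` is even).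
[cite: Balaban1983Higgs3, (1.24) p.417] -/
theorem iteratedDeriv_odd_logZ_curve {ct : ℝ → ℝ} (hct : ∀ e, ct (-e) = ct e) (k : ℕ) :
    iteratedDeriv (2 * k + 1) (fun e => Real.log (∫ p : JCfg P j N, J C η w c (m2 + ct e) μ2 e p)) 0 = 0 :=
  iteratedDeriv_odd_eq_zero_of_even' (fun e => by simp only [Z_curve_neg_charge C η w c m2 μ2 hct]) k

omit C η w c m2 μ2 in
/-- r15's typed series (1.23) at `λ = 0` is the polynomial `δm²_{(2,0)}e² + δm²_{(3,0)}e³ + δm²_{(4,0)}e⁴` (the index set of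
`B3Sect1TwoPoint.dm2Of123` is `{(2,0),(3,0),(4,0),(0,1),(1,1),(2,1),(0,2)}`; the `β ≥ 1` terms carry `λ^β = 0`).
[cite: Balaban1983Higgs3, (1.23) p.417] -/
private theorem dm2Of123_at_lam_zero {X : Type*} [Fintype X] (e epsd : ℝ) (S : ℕ → ℕ → X → ℝ) :
    B3Sect1TwoPoint.dm2Of123 e 0 epsd S =
      B3Sect1TwoPoint.dm2Coeff epsd S 2 0 * e ^ 2 + B3Sect1TwoPoint.dm2Coeff epsd S 3 0 * e ^ 3
        + B3Sect1TwoPoint.dm2Coeff epsd S 4 0 * e ^ 4 := by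
  simp [B3Sect1TwoPoint.dm2Of123, B3Sect1TwoPoint.idx123_eq]
  ring

/-- **PRINT'S INDEX `(3,0)` OF (1.24)**: with r15's typed series (1.23) inserted at `λ = 0` and `δm²_{(3,0)} = 0` (as (1.23) has it,
and as BRICK 10 derived for the two-point side), the order-`e³` term of `log Z^ε` vanishes. [cite: Balaban1983Higgs3, (1.23)–(1.24) p.417] -/
theorem iteratedDeriv_three_logZ_dm2Of123 {X : Type*} [Fintype X] (epsd : ℝ) (S : ℕ → ℕ → X → ℝ)
    (h30 : B3Sect1TwoPoint.dm2Coeff epsd S 3 0 = 0) :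
    iteratedDeriv 3 (fun e => Real.log (∫ p : JCfg P j N,
      J C η w c (m2 + B3Sect1TwoPoint.dm2Of123 e 0 epsd S) μ2 e p)) 0 = 0 := by
  have hct : ∀ e : ℝ, B3Sect1TwoPoint.dm2Of123 (-e) 0 epsd S = B3Sect1TwoPoint.dm2Of123 e 0 epsd S := fun e => by
    rw [dm2Of123_at_lam_zero, dm2Of123_at_lam_zero, h30]
    ring
  exact iteratedDeriv_odd_logZ_curve C η w c m2 μ2 hct 1

end Parity

/-! ## §5 THE PRINT'S FORM at `c·η = 1` (`c = ε⁻¹`, the difference quotients of B1 (1.4)): bonds as (initial point, direction),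
the theta in r15's `d1Kernel = ∂^ε_μC₀` / `dKernel = ∂^ε_μC₀∂^{ε*}_μ` vocabulary, the point-splitting of the figure-eight -/

section PrintForm

omit C η in
/-- **THE THETA BRACKET IN THE PRINT'S `∂^ε`-FORM** (a polynomial identity in the propagator values, `C₀` symmetric):
`c²·[C₀(y,y′⁺)C₀(y⁺,y′) − C₀(y,y′)C₀(y⁺,y′⁺)] = (∂^ε_μC₀)(y,y′)·(∂^ε_μC₀)(y′,y) − C₀(y,y′)·(∂^ε_μC₀∂^{ε*}_μ)(y,y′)` (`y⁺ = y + εe_μ`) —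
the two placements of the lattice derivatives of the two cubic vertices (1.8)₁,₀ on the scalar loop: one on each line (r15's
`d1Kernel` twice), or both on the same line (r15's `dKernel`, the pattern of ④ of (1.22)) with the other line plain.
[cite: Balaban1983Higgs3, (1.8) p.413, (1.22) term ④ p.416] -/
theorem sq_mul_theta_eq (μ : Fin P.d) (y y' : Site P j) :
    c ^ 2 * (G w c m2 y (y'.shift μ) * G w c m2 (y.shift μ) y' - G w c m2 y y' * G w c m2 (y.shift μ) (y'.shift μ)) =
      d1Kernel c μ (G w c m2) y y' * d1Kernel c μ (G w c m2) y' y - G w c m2 y y' * dKernel c μ (G w c m2) y y' := by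
  simp only [d1Kernel, dKernel]
  rw [G_symm w c m2 (y'.shift μ) y, G_symm w c m2 y' y]
  ring

omit C in
/-- **THE POINT-SPLITTING OF THE FIGURE-EIGHT**: the quartic term of `U(ηeA_b)` has its two fields at the two ENDS of the bond
(`½(ηeA_b)²⟪φ(b₋),q²φ(b₊)⟫ = ½(ηeA_b)²[⟪φ(b₋),q²φ(b₋)⟫ + η⟪φ(b₋),q²∂^ηφ(b)⟫]`, the vertices (1.8)₂,₀ and (1.10)₂,₀), so its scalar
loop is `C₀(y,y+εe_μ) = C₀(y,y) + ε·(∂^ε_μC₀)(y,y)`: summed over the directions,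
`Σ_μC₀(y,y+εe_μ) = d·C₀(y,y) + εΣ_μ(∂^ε_μC₀)(y,y)` (at `cε = 1`). [cite: Balaban1983Higgs3, (1.8), (1.10) p.413] -/
theorem sum_G_shift_eq (hcη : c * η = 1) (y : Site P j) :
    ∑ μ : Fin P.d, G w c m2 y (y.shift μ) =
      (P.d : ℝ) * G w c m2 y y + η * ∑ μ : Fin P.d, d1Kernel c μ (G w c m2) y y := by
  rw [Finset.mul_sum]
  trans ∑ μ : Fin P.d, (G w c m2 y y + η * d1Kernel c μ (G w c m2) y y)
  · refine Finset.sum_congr rfl fun μ _ => ?_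
    simp only [d1Kernel]
    rw [G_symm w c m2 y (y.shift μ)]
    linear_combination (G w c m2 y y - G w c m2 (y.shift μ) y) * hcη
  · rw [Finset.sum_add_distrib, Finset.sum_const, Finset.card_univ, Fintype.card_fin, nsmul_eq_mul]

/-- **`d²/de²∣₀ log Z^{ct}` IN THE PRINT'S FORM** (`cε = 1`; bonds `b = ⟨y, y + εe_μ⟩`; the direction-diagonal vector covariance
`⟨A_bA_{b′}⟩ = δ_{μμ′}C^ε(y,y′)`):
`d²/de²∣₀ log∫dA dφ e^{−S^ε_e} = tr(q²)·[Σ_{y,μ}η^dC^ε(y,y)C₀(y,y+εe_μ) + Σ_{y,y′,μ}η^{2d}C^ε(y,y′)((∂^ε_μC₀)(y,y′)(∂^ε_μC₀)(y′,y) −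
C₀(y,y′)(∂^ε_μC₀∂^{ε*}_μ)(y,y′))] − (ct″(0)/2)·N·Σ_xη^dC₀(x,x)`. [cite: Balaban1983Higgs3, (1.22) p.416, (1.24) p.417] -/
theorem iteratedDeriv_two_logZ_curve_eq_lattice (hw : 0 < w) (hm : 0 < m2) (hμ : 0 < μ2) (hcη : c * η = 1)
    {ct ct' ct'' : ℝ → ℝ} (hd : ∀ e, HasDerivAt ct (ct' e) e) (hd' : ∀ e, HasDerivAt ct' (ct'' e) e)
    (hc'' : ContinuousAt ct'' 0) (h0 : ct 0 = 0) (h0' : ct' 0 = 0) :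
    iteratedDeriv 2 (fun e => Real.log (∫ p : JCfg P j N, J C η w c (m2 + ct e) μ2 e p)) 0 =
      trE (C.q.comp C.q) *
          ((∑ y : Site P j, ∑ μ : Fin P.d, w * G w c μ2 y y * G w c m2 y (y.shift μ))
            + ∑ y : Site P j, ∑ y' : Site P j, ∑ μ : Fin P.d, w * w * G w c μ2 y y' *
                (d1Kernel c μ (G w c m2) y y' * d1Kernel c μ (G w c m2) y' y - G w c m2 y y' * dKernel c μ (G w c m2) y y'))
        - ct'' 0 / 2 * ((N : ℝ) * ∑ x : Site P j, w * G w c m2 x x) := by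
  rw [iteratedDeriv_two_logZ_curve C η w c m2 μ2 hw hm hμ hd hd' hc'' h0 h0']
  have hc2 : c ^ 2 * η ^ 2 = 1 := by linear_combination (c * η + 1) * hcη
  have hκ : (w * (c ^ 2 * η)) * (w * (c ^ 2 * η)) = w * w * c ^ 2 := by
    linear_combination (w * w * c ^ 2 * (c * η + 1)) * hcη
  have hX1 : (∑ b : PBond P j, w * (c ^ 2 * η ^ 2) * G w c μ2 b.src b.src * G w c m2 b.src b.tgt) =
      ∑ y : Site P j, ∑ μ : Fin P.d, w * G w c μ2 y y * G w c m2 y (y.shift μ) := by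
    rw [sum_bond]
    refine Finset.sum_congr rfl fun y _ => Finset.sum_congr rfl fun μ _ => ?_
    simp only [PBond.tgt, hc2, mul_one]
  have hX2 : (∑ b : PBond P j, ∑ b' : PBond P j, (w * (c ^ 2 * η)) * (w * (c ^ 2 * η)) *
        (G w c μ2 b.src b'.src * if b.dir = b'.dir then 1 else 0) *
          (G w c m2 b.src b'.tgt * G w c m2 b.tgt b'.src - G w c m2 b.src b'.src * G w c m2 b.tgt b'.tgt)) =
      ∑ y : Site P j, ∑ y' : Site P j, ∑ μ : Fin P.d, w * w * G w c μ2 y y' *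
        (d1Kernel c μ (G w c m2) y y' * d1Kernel c μ (G w c m2) y' y - G w c m2 y y' * dKernel c μ (G w c m2) y y') := by
    calc _ = ∑ b : PBond P j, ∑ b' : PBond P j, (if b.dir = b'.dir then (1 : ℝ) else 0) *
          (w * w * G w c μ2 b.src b'.src * (c ^ 2 *
            (G w c m2 b.src b'.tgt * G w c m2 b.tgt b'.src - G w c m2 b.src b'.src * G w c m2 b.tgt b'.tgt))) := by
            refine Finset.sum_congr rfl fun b _ => Finset.sum_congr rfl fun b' _ => ?_
            rw [hκ]; ring
      _ = ∑ y : Site P j, ∑ y' : Site P j, ∑ μ : Fin P.d, w * w * G w c μ2 y y' * (c ^ 2 *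
            (G w c m2 y (y'.shift μ) * G w c m2 (y.shift μ) y' - G w c m2 y y' * G w c m2 (y.shift μ) (y'.shift μ))) := by
            rw [sum_bond_bond_dir]
            simp only [PBond.tgt]
      _ = _ := by
            simp only [sq_mul_theta_eq]
  rw [hX1, hX2]

/-- **THE FIGURE-EIGHT SPLIT**: `Σ_{y,μ}η^dC^ε(y,y)C₀(y,y+εe_μ) = d·Σ_yη^dC^ε(y,y)C₀(y,y) + εΣ_{y,μ}η^dC^ε(y,y)(∂^ε_μC₀)(y,y)` — the
`(1.8)₂,₀` part (an `A`-tadpole `C^ε(0)` with the trace `Σ_μ = d` over its direction, times the scalar loop `C₀(0)`: print's ② of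
(1.22)/(1.23) closed on itself) and the `(1.10)₂,₀` point-splitting remnant (one explicit factor `ε`).
[cite: Balaban1983Higgs3, (1.8), (1.10) p.413, (1.22) term ② p.416] -/
theorem figureEight_split (hcη : c * η = 1) :
    (∑ y : Site P j, ∑ μ : Fin P.d, w * G w c μ2 y y * G w c m2 y (y.shift μ)) =
      (P.d : ℝ) * (∑ y : Site P j, w * G w c μ2 y y * G w c m2 y y)
        + η * ∑ y : Site P j, ∑ μ : Fin P.d, w * G w c μ2 y y * d1Kernel c μ (G w c m2) y y := by
  have h : ∀ y : Site P j, (∑ μ : Fin P.d, w * G w c μ2 y y * G w c m2 y (y.shift μ)) =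
      (P.d : ℝ) * (w * G w c μ2 y y * G w c m2 y y) + η * ∑ μ : Fin P.d, w * G w c μ2 y y * d1Kernel c μ (G w c m2) y y := by
    intro y
    rw [← Finset.mul_sum, sum_G_shift_eq η w c m2 hcη y]
    simp only [mul_add, Finset.mul_sum]
    congr 1
    · ring
    · exact Finset.sum_congr rfl fun μ _ => by ring
  rw [Finset.sum_congr rfl fun y _ => h y, Finset.sum_add_distrib, ← Finset.mul_sum, ← Finset.mul_sum]

end PrintForm


/-! ## §6 PRINT'S COUNTERTERMS INSERTED: the quadratic curve `δm² = δe²`, r15's typed series (1.23) at `λ = 0`, no counterterm -/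

section Specializations

omit C η w c m2 μ2 in
/-- the quadratic curve `δe²` and its derivative `2δe`. [folklore] -/
private theorem hasDerivAt_quad (δ e : ℝ) : HasDerivAt (fun s : ℝ => δ * s ^ 2) (δ * (2 * e)) e := by
  have h := ((hasDerivAt_id e).pow 2).const_mul δ
  simpa using h

omit C η w c m2 μ2 in
/-- `d/de(2δe) = 2δ`. [folklore] -/
private theorem hasDerivAt_quad' (δ e : ℝ) : HasDerivAt (fun s : ℝ => δ * (2 * s)) (δ * 2) e := by
  have h := ((hasDerivAt_id e).const_mul 2).const_mul δ
  simpa using h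

/-- **(1.24) AT ORDER `e²` WITH PRINT'S WEIGHT-2 COUNTERTERM `δm² = δm²_{(2,0)}e²`** (`δ = δm²_{(2,0)}`):
`d²/de²∣₀ log∫dA dφ e^{−S^ε_e} = tr(q²)·[figure-eight + theta] − δm²_{(2,0)}·N·Σ_xη^dC₀(x,x)` (`ct″(0)/2 = δ`).
[cite: Balaban1983Higgs3, (1.23)–(1.24) p.417] -/
theorem iteratedDeriv_two_logZ_quadratic (hw : 0 < w) (hm : 0 < m2) (hμ : 0 < μ2) (δ : ℝ) :
    iteratedDeriv 2 (fun e => Real.log (∫ p : JCfg P j N, J C η w c (m2 + δ * e ^ 2) μ2 e p)) 0 =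
      trE (C.q.comp C.q) *
          ((∑ b : PBond P j, w * (c ^ 2 * η ^ 2) * G w c μ2 b.src b.src * G w c m2 b.src b.tgt)
            + ∑ b : PBond P j, ∑ b' : PBond P j, (w * (c ^ 2 * η)) * (w * (c ^ 2 * η)) *
                (G w c μ2 b.src b'.src * if b.dir = b'.dir then 1 else 0) *
                  (G w c m2 b.src b'.tgt * G w c m2 b.tgt b'.src - G w c m2 b.src b'.src * G w c m2 b.tgt b'.tgt))
        - δ * ((N : ℝ) * ∑ x : Site P j, w * G w c m2 x x) := by
  have h := iteratedDeriv_two_logZ_curve (P := P) (j := j) C η w c m2 μ2 hw hm hμ (ct := fun s => δ * s ^ 2)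
    (ct' := fun s => δ * (2 * s)) (ct'' := fun _ => δ * 2) (hasDerivAt_quad δ) (hasDerivAt_quad' δ) continuousAt_const
    (by ring) (by ring)
  rw [h]
  ring

/-- **(1.24) AT ORDER `e²` WITHOUT COUNTERTERM** (`δm² = 0`: BRICK 7's setting): `d²/de²∣₀ log Z^ε_e = tr(q²)·[figure-eight +
theta]`. [cite: Balaban1983Higgs3, (1.24) p.417] -/
theorem iteratedDeriv_two_logZ_noCounterterm (hw : 0 < w) (hm : 0 < m2) (hμ : 0 < μ2) :
    iteratedDeriv 2 (fun e => Real.log (∫ p : JCfg P j N, J C η w c m2 μ2 e p)) 0 =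
      trE (C.q.comp C.q) *
          ((∑ b : PBond P j, w * (c ^ 2 * η ^ 2) * G w c μ2 b.src b.src * G w c m2 b.src b.tgt)
            + ∑ b : PBond P j, ∑ b' : PBond P j, (w * (c ^ 2 * η)) * (w * (c ^ 2 * η)) *
                (G w c μ2 b.src b'.src * if b.dir = b'.dir then 1 else 0) *
                  (G w c m2 b.src b'.tgt * G w c m2 b.tgt b'.src - G w c m2 b.src b'.src * G w c m2 b.tgt b'.tgt)) := by
  have h := iteratedDeriv_two_logZ_quadratic (P := P) (j := j) C η w c m2 μ2 hw hm hμ 0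
  simp only [zero_mul, add_zero, sub_zero] at h
  exact h

/-- **WITH versus WITHOUT THE COUNTERTERM**: the order-`e²` vacuum term for print's `δm² = δm²_{(2,0)}e²` inserted in `S^ε` (the
reading of (1.24): *"In S^ε … we of course have dropped the term E"* — only `E`) and the one for `δm² = 0` DIFFER EXACTLY BY THE
COUNTERTERM BUBBLE: `d²/de²∣₀ log Z^{δe²} = d²/de²∣₀ log Z^{0} − δ·N·Σ_xη^dC₀(x,x)` (the mass vertex (1.7) closed on a scalar loop).
[cite: Balaban1983Higgs3, (1.7) p.413, (1.24) p.417, p.418] -/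
theorem iteratedDeriv_two_logZ_quadratic_sub_noCounterterm (hw : 0 < w) (hm : 0 < m2) (hμ : 0 < μ2) (δ : ℝ) :
    iteratedDeriv 2 (fun e => Real.log (∫ p : JCfg P j N, J C η w c (m2 + δ * e ^ 2) μ2 e p)) 0 =
      iteratedDeriv 2 (fun e => Real.log (∫ p : JCfg P j N, J C η w c m2 μ2 e p)) 0
        - δ * ((N : ℝ) * ∑ x : Site P j, w * G w c m2 x x) := by
  rw [iteratedDeriv_two_logZ_quadratic C η w c m2 μ2 hw hm hμ δ, iteratedDeriv_two_logZ_noCounterterm C η w c m2 μ2 hw hm hμ]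

omit C η w c m2 μ2 in
/-- the polynomial `δ₂e² + δ₃e³ + δ₄e⁴` and its first derivative. [folklore] -/
private theorem hasDerivAt_poly (δ₂ δ₃ δ₄ e : ℝ) :
    HasDerivAt (fun s : ℝ => δ₂ * s ^ 2 + δ₃ * s ^ 3 + δ₄ * s ^ 4)
      (δ₂ * (2 * e) + δ₃ * (3 * e ^ 2) + δ₄ * (4 * e ^ 3)) e := by
  have h : HasDerivAt (fun s : ℝ => δ₂ * s ^ 2 + δ₃ * s ^ 3 + δ₄ * s ^ 4)
      (δ₂ * ((2 : ℕ) * e ^ (2 - 1)) + δ₃ * ((3 : ℕ) * e ^ (3 - 1)) + δ₄ * ((4 : ℕ) * e ^ (4 - 1))) e :=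
    (((hasDerivAt_pow 2 e).const_mul δ₂).add ((hasDerivAt_pow 3 e).const_mul δ₃)).add
      ((hasDerivAt_pow 4 e).const_mul δ₄)
  refine h.congr_deriv ?_
  norm_num

omit C η w c m2 μ2 in
/-- … and its second derivative. [folklore] -/
private theorem hasDerivAt_poly' (δ₂ δ₃ δ₄ e : ℝ) :
    HasDerivAt (fun s : ℝ => δ₂ * (2 * s) + δ₃ * (3 * s ^ 2) + δ₄ * (4 * s ^ 3))
      (δ₂ * 2 + δ₃ * (3 * (2 * e)) + δ₄ * (4 * (3 * e ^ 2))) e := by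
  have h : HasDerivAt (fun s : ℝ => δ₂ * (2 * s) + δ₃ * (3 * s ^ 2) + δ₄ * (4 * s ^ 3))
      (δ₂ * (2 * 1) + δ₃ * (3 * ((2 : ℕ) * e ^ (2 - 1))) + δ₄ * (4 * ((3 : ℕ) * e ^ (3 - 1)))) e :=
    ((((hasDerivAt_id' e).const_mul (2 : ℝ)).const_mul δ₂).add
      (((hasDerivAt_pow 2 e).const_mul (3 : ℝ)).const_mul δ₃)).add (((hasDerivAt_pow 3 e).const_mul (4 : ℝ)).const_mul δ₄)
  refine h.congr_deriv ?_
  norm_num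

/-- **(1.24) AT ORDER `e²` WITH r15's TYPED SERIES (1.23) INSERTED AT `λ = 0`** (`δm²(e) = δm²_{(2,0)}e² + δm²_{(3,0)}e³ +
δm²_{(4,0)}e⁴`, `B3Sect1TwoPoint.dm2Of123 e 0 ε^d Σ^ε_{(·,·)}` for ANY supplied coefficients): **ONLY `δm²_{(2,0)}` ENTERS THE
ORDER-`e²` VACUUM TERM** — `d²/de²∣₀ log Z^ε = tr(q²)·[figure-eight + theta] − δm²_{(2,0)}·N·Σ_xη^dC₀(x,x)`,
`δm²_{(2,0)} = dm2Coeff ε^d Σ^ε 2 0 = Σ_xε^dΣ^ε_{(2,0)}(x)` — print's *"we insert this into Σ^ε … and we take a sum of terms of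
order ≦ 4"* read on the vacuum side. [cite: Balaban1983Higgs3, (1.23)–(1.24) p.417] -/
theorem iteratedDeriv_two_logZ_dm2Of123 (hw : 0 < w) (hm : 0 < m2) (hμ : 0 < μ2) {X : Type*} [Fintype X]
    (epsd : ℝ) (S : ℕ → ℕ → X → ℝ) :
    iteratedDeriv 2 (fun e => Real.log (∫ p : JCfg P j N,
        J C η w c (m2 + B3Sect1TwoPoint.dm2Of123 e 0 epsd S) μ2 e p)) 0 =
      trE (C.q.comp C.q) *
          ((∑ b : PBond P j, w * (c ^ 2 * η ^ 2) * G w c μ2 b.src b.src * G w c m2 b.src b.tgt)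
            + ∑ b : PBond P j, ∑ b' : PBond P j, (w * (c ^ 2 * η)) * (w * (c ^ 2 * η)) *
                (G w c μ2 b.src b'.src * if b.dir = b'.dir then 1 else 0) *
                  (G w c m2 b.src b'.tgt * G w c m2 b.tgt b'.src - G w c m2 b.src b'.src * G w c m2 b.tgt b'.tgt))
        - B3Sect1TwoPoint.dm2Coeff epsd S 2 0 * ((N : ℝ) * ∑ x : Site P j, w * G w c m2 x x) := by
  set δ₂ := B3Sect1TwoPoint.dm2Coeff epsd S 2 0 with hδ₂
  set δ₃ := B3Sect1TwoPoint.dm2Coeff epsd S 3 0 with hδ₃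
  set δ₄ := B3Sect1TwoPoint.dm2Coeff epsd S 4 0 with hδ₄
  have hfun : (fun e => Real.log (∫ p : JCfg P j N, J C η w c (m2 + B3Sect1TwoPoint.dm2Of123 e 0 epsd S) μ2 e p)) =
      fun e => Real.log (∫ p : JCfg P j N, J C η w c (m2 + (δ₂ * e ^ 2 + δ₃ * e ^ 3 + δ₄ * e ^ 4)) μ2 e p) := by
    funext e
    rw [dm2Of123_at_lam_zero]
  rw [hfun]
  have h := iteratedDeriv_two_logZ_curve (P := P) (j := j) C η w c m2 μ2 hw hm hμ
    (ct := fun s => δ₂ * s ^ 2 + δ₃ * s ^ 3 + δ₄ * s ^ 4)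
    (ct' := fun s => δ₂ * (2 * s) + δ₃ * (3 * s ^ 2) + δ₄ * (4 * s ^ 3))
    (ct'' := fun s => δ₂ * 2 + δ₃ * (3 * (2 * s)) + δ₄ * (4 * (3 * s ^ 2))) (hasDerivAt_poly δ₂ δ₃ δ₄)
    (hasDerivAt_poly' δ₂ δ₃ δ₄) (by fun_prop) (by ring) (by ring)
  rw [h]
  ring

end Specializations

/-! ## §7 THE ORDER-`e²` TERM OF `E₁` WITH PRINT'S `δm²_{(2,0)}` (the (2,0) solution `e²δm²_{(2,0)} = ct2 + ct4` of the
defining equation of (1.23), BRICK 10 `condition_20_iff`): THE FIGURE-EIGHT'S `C^ε_0(0)`-TADPOLE CANCELS THE `②`-BUBBLE EXACTLY,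
THE THETA'S `④`-PLACEMENT APPEARS SUBTRACTED AT ZERO MOMENTUM -/

section PrintCounterterm

/-- **THE ORDER-`e²` TERM OF THE VACUUM-ENERGY COUNTERTERM (1.24) WITH PRINT'S MASS COUNTERTERM INSERTED.**  P. 417: *"E₁ =
Σ_{1≤α+β≤n̄}(α!β!)⁻¹e^αλ^β(∂^{α+β}/∂e^α∂λ^β log∫dA∫dφ e^{−S^ε(A,φ)})∣_{e=λ=0}"*, with (p. 418) *"In S^ε, defined in (I.1.11), we
of course have dropped the term E"* ((I.1.11) = B1's (1.11): (1.20) plus the constant `E`, `m₀² = m² + δm²`) — so the mass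
counterterm (1.23) IS in `S^ε`.  At `(α,β) = (2,0)` only the weight-2 term
`e²δm²_{(2,0)}` of (1.23) enters (§6), and print's `δm²_{(2,0)}` is the solution of the defining equation «`−δm²_{(2,0)} +
Σ_{x′}ε^dΣ^ε_{(2,0)}(x−x′) = 0`» for the DERIVED order-`e²` self-energy, i.e. `e²δm²_{(2,0)} = ct2 D + ct4 D` (p26's typed second and
fourth counterterms of (1.23): `e²dC^ε(0)q²` and `−e²Σ_{x′}ε^dΣ_μ q(∂^ε_μC^ε_0∂^{ε*}_μ)(x−x′)qC^ε(x−x′)`; BRICK 10 `condition_20_iff`/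
`condition_20_iff_explicit` — here the hypothesis `hδ`, at every site).  THEN, at `cε = 1` and for a charge matrix with scalar
square (`tr q² = N·q2`, `q2 = (q²)_{aa}` p26's charge factor; hypothesis `htr`), the `(2,0)` term of `E₁` is
`(e²/2)·d²/de²∣₀ log Z^ε = ½N·Σ_{y,y′}ε^{2d}·sig4 D(y,y′)·[C₀(y′,y) − C₀(y,y)] + ½N·e²q2·Σ_{y,y′,μ}ε^{2d}C^ε(y,y′)(∂^ε_μC₀)(y,y′)(∂^ε_μC₀)(y′,y)
+ ½N·ε·e²q2·Σ_{y,μ}ε^dC^ε(y,y)(∂^ε_μC₀)(y,y)`: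
(i) the THETA in its ④-placement — p26's typed ④ `sig4 = −e²Σ_μq²(∂^ε_μC^ε_0∂^{ε*}_μ)C^ε` closed by a scalar line — appears
SUBTRACTED AT ZERO MOMENTUM, `C₀(y′,y) − C₀(y,y)`, the subtraction being exactly the `ct4`-bubble (print p. 417: *"δm² is chosen in
such a way that −δm² + Σ^ε is convergent"*); (ii) the `C^ε_0(0)`-part of the FIGURE-EIGHT (②, `e²dC^ε(0)q²`, closed on a scalar
loop `C₀(0)`) CANCELS THE `ct2`-BUBBLE IDENTICALLY; what remains of it is (iii) the point-splitting remnant of the vertex (1.10)₂,₀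
(one explicit factor `ε`), and (iv) the theta in its `Σ₂`-placement (one lattice derivative on each scalar line; BRICK 7's
companion `sgTwo`).  Nothing is claimed about the size of (i)–(iv) as `ε → 0`, nor about the terms of (1.24) with `β ≥ 1` (BRICK 12
§10 derives `(0,1)`, `(0,2)` at `e = 0`), nor about `(4,0)`.
[cite: Balaban1983Higgs3, (1.22) p.416, (1.23)–(1.24) p.417, p.418] -/
theorem vacuum_secondOrder_at_print_counterterm (hw : 0 < w) (hm : 0 < m2) (hμ : 0 < μ2) (hcη : c * η = 1) (e δ : ℝ)
    (D : SEData P j) (he : D.e = e) (hC0 : D.C0 = G w c m2) (hC : D.C = G w c μ2) (hwD : D.w = w) (hcD : D.c = c)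
    (hε : D.ε ≠ 0) (htr : trE (C.q.comp C.q) = (N : ℝ) * D.q2) (hδ : ∀ y : Site P j, e ^ 2 * δ = ct2 D y + ct4 D y) :
    e ^ 2 / 2 * iteratedDeriv 2 (fun s => Real.log (∫ p : JCfg P j N, J C η w c (m2 + δ * s ^ 2) μ2 s p)) 0 =
      1 / 2 * (N : ℝ) * (∑ y : Site P j, ∑ y' : Site P j, w * w * sig4 D y y' * (G w c m2 y' y - G w c m2 y y))
        + 1 / 2 * (N : ℝ) * (e ^ 2 * D.q2) *
            (∑ y : Site P j, ∑ y' : Site P j, ∑ μ : Fin P.d, w * w * G w c μ2 y y' *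
              (d1Kernel c μ (G w c m2) y y' * d1Kernel c μ (G w c m2) y' y))
        + 1 / 2 * (N : ℝ) * (η * (e ^ 2 * D.q2)) *
            ∑ y : Site P j, ∑ μ : Fin P.d, w * G w c μ2 y y * d1Kernel c μ (G w c m2) y y := by
  rw [iteratedDeriv_two_logZ_curve_eq_lattice C η w c m2 μ2 hw hm hμ hcη (ct := fun s => δ * s ^ 2)
    (ct' := fun s => δ * (2 * s)) (ct'' := fun _ => δ * 2) (hasDerivAt_quad δ) (hasDerivAt_quad' δ) continuousAt_const
    (by ring) (by ring), figureEight_split η w c m2 μ2 hcη, htr]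
  -- name the lattice sums
  set S8a : ℝ := ∑ y : Site P j, w * G w c μ2 y y * G w c m2 y y with hS8a
  set S8b : ℝ := ∑ y : Site P j, ∑ μ : Fin P.d, w * G w c μ2 y y * d1Kernel c μ (G w c m2) y y with hS8b
  set T1 : ℝ := ∑ y : Site P j, ∑ y' : Site P j, ∑ μ : Fin P.d, w * w * G w c μ2 y y' *
    (d1Kernel c μ (G w c m2) y y' * d1Kernel c μ (G w c m2) y' y) with hT1
  set T2 : ℝ := ∑ y : Site P j, ∑ y' : Site P j, ∑ μ : Fin P.d, w * w * G w c μ2 y y' *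
    (G w c m2 y y' * dKernel c μ (G w c m2) y y') with hT2
  set S0 : ℝ := ∑ x : Site P j, w * G w c m2 x x with hS0
  have hT : (∑ y : Site P j, ∑ y' : Site P j, ∑ μ : Fin P.d, w * w * G w c μ2 y y' *
      (d1Kernel c μ (G w c m2) y y' * d1Kernel c μ (G w c m2) y' y - G w c m2 y y' * dKernel c μ (G w c m2) y y')) =
      T1 - T2 := by
    simp only [hT1, hT2, mul_sub, Finset.sum_sub_distrib]
  -- the `ct2`-bubble is the `C₀(0)`-tadpole of the figure-eight
  have hct2S : (∑ y : Site P j, w * G w c m2 y y * ct2 D y) = e ^ 2 * (P.d : ℝ) * D.q2 * S8a := by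
    rw [hS8a, Finset.mul_sum]
    refine Finset.sum_congr rfl fun y _ => ?_
    rw [ct2_eq D hε y, he, hC]
    ring
  -- the `ct4`-bubble is ④ closed at zero momentum
  have hct4S : (∑ y : Site P j, w * G w c m2 y y * ct4 D y) =
      ∑ y : Site P j, ∑ y' : Site P j, w * w * sig4 D y y' * G w c m2 y y := by
    refine Finset.sum_congr rfl fun y _ => ?_
    simp only [ct4, B3Sect1TwoPoint.dm2Graph, hwD, Finset.mul_sum]
    exact Finset.sum_congr rfl fun y' _ => by ring
  -- ④ closed by a propagator is the theta in its `dKernel` placement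
  have hsig4S : (∑ y : Site P j, ∑ y' : Site P j, w * w * sig4 D y y' * G w c m2 y' y) = -(e ^ 2 * D.q2) * T2 := by
    rw [hT2, Finset.mul_sum]
    refine Finset.sum_congr rfl fun y _ => ?_
    rw [Finset.mul_sum]
    refine Finset.sum_congr rfl fun y' _ => ?_
    simp only [sig4, he, hC0, hC, hcD]
    rw [G_symm w c m2 y' y, Finset.mul_sum, Finset.mul_sum, Finset.sum_mul, Finset.mul_sum]
    exact Finset.sum_congr rfl fun μ _ => by ring
  -- print's `δm²_{(2,0)}`: `e²δ = ct2 + ct4`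
  have hδS : e ^ 2 * δ * S0 = (∑ y : Site P j, w * G w c m2 y y * ct2 D y) + ∑ y : Site P j, w * G w c m2 y y * ct4 D y := by
    rw [← Finset.sum_add_distrib, hS0, Finset.mul_sum]
    refine Finset.sum_congr rfl fun y _ => ?_
    rw [← mul_add, ← hδ y]
    ring
  have hR : (∑ y : Site P j, ∑ y' : Site P j, w * w * sig4 D y y' * (G w c m2 y' y - G w c m2 y y)) =
      -(e ^ 2 * D.q2) * T2 - ∑ y : Site P j, w * G w c m2 y y * ct4 D y := by
    rw [hct4S, ← hsig4S, ← Finset.sum_sub_distrib]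
    refine Finset.sum_congr rfl fun y _ => ?_
    rw [← Finset.sum_sub_distrib]
    exact Finset.sum_congr rfl fun y' _ => by ring
  rw [hT, hR]
  linear_combination (-(1 / 2 : ℝ) * N) * hct2S + (-(1 / 2 : ℝ) * N) * hδS

end PrintCounterterm


/-! ## §8 THE (1.10)₂,₀ REMNANT IS A CONTACT TERM: the lattice equation `(−Δ^ε+m²)C^ε_0 = δ^ε` at coinciding points gives
`Σ_μ(∂^ε_μC₀)(y,y) = (ε/2)(m²C₀(y,y) − ε^{−d})` -/

section Remnant

open Matrix

omit C η w c m2 μ2 in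
/-- translation by the unit vector `e_μ` is the nearest-neighbour shift `x ↦ x + e_μ`. [folklore] -/
private theorem transl_single_one (μ : Fin P.d) (x : Site P j) :
    transl (Pi.single μ (1 : ZMod (P.sitesPerDir j))) x = x.shift μ := by
  funext ν
  unfold transl Site.shift
  by_cases h : ν = μ
  · subst h
    rw [Function.update_self, Pi.single_eq_same]
  · rw [Function.update_of_ne h, Pi.single_eq_of_ne h, add_zero]

omit C η w c m2 μ2 in
/-- `(x − e_μ) + e_μ = x`. [folklore] -/
private theorem shift_unshift'' (x : Site P j) (μ : Fin P.d) : (x.unshift μ).shift μ = x :=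
  (shiftEquiv (P := P) (j := j) μ).apply_symm_apply x

omit C η w c m2 μ2 in
/-- `(x + e_μ) − e_μ = x`. [folklore] -/
private theorem unshift_shift'' (x : Site P j) (μ : Fin P.d) : (x.shift μ).unshift μ = x :=
  (shiftEquiv (P := P) (j := j) μ).symm_apply_apply x

omit C η μ2 in
/-- one step of translation invariance: `C₀(x − e_μ, x) = C₀(x, x + e_μ)`. [cite: Balaban1983Higgs3, (2.26) p.431] -/
private theorem G_unshift_eq (x : Site P j) (μ : Fin P.d) : G w c m2 (x.unshift μ) x = G w c m2 x (x.shift μ) := by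
  have h := G_transl w c m2 (Pi.single μ (1 : ZMod (P.sitesPerDir j))) (x.unshift μ) x
  rw [transl_single_one, transl_single_one, shift_unshift''] at h
  exact h.symm

omit C η μ2 in
/-- **THE LATTICE EQUATION `(−Δ^ε+m²)C^ε_0 = δ^ε` AT COINCIDING POINTS**, print form:
`Σ_μ 2c²(C₀(y,y) − C₀(y+εe_μ,y)) + m²C₀(y,y) = ε^{−d}` (`c = ε⁻¹`; the column `C₀(·,y)` solves `η^d(−Δ^η+m²)C₀(·,y) = δ_y`,
this seat's `B3WTPropagator.Ks_mulVec_Gcol`, read at the point `y` with the backward neighbours moved forward by translation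
invariance). [cite: Balaban1983Higgs3, (1.21) p.416 («C^ε_0 = (−Δ^ε_0+m²)^{−1}»), (2.26) p.431] -/
theorem latticeEq_diag (hw : 0 < w) (hm : 0 < m2) (y : Site P j) :
    (∑ μ : Fin P.d, 2 * (c ^ 2 * (G w c m2 y y - G w c m2 (y.shift μ) y))) + m2 * G w c m2 y y = w⁻¹ := by
  classical
  -- `⟨δ_y,(−Δ^η+m²)C₀(·,y)⟩ = δ_y·(K C₀(·,y)) = δ_y·δ_y = 1`
  have h1 : sform w c m2 (Pi.single y 1) (fun z => G w c m2 z y) = 1 := by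
    rw [sform_eq_dotProduct, Ks_mulVec_Gcol w c m2 hw hm y, single_dotProduct, one_mul, Pi.single_eq_same]
  unfold sform at h1
  -- the mass term: `m²Σ_xη^dδ_y(x)C₀(x,y) = m²η^dC₀(y,y)`
  have hmass : (∑ x : Site P j, w * ((Pi.single y (1 : ℝ) : Site P j → ℝ) x * G w c m2 x y)) = w * G w c m2 y y := by
    rw [Finset.sum_eq_single y]
    · rw [Pi.single_eq_same, one_mul]
    · intro x _ hx
      rw [Pi.single_eq_of_ne hx, zero_mul, mul_zero]
    · intro h; exact absurd (Finset.mem_univ y) h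
  -- the bond term: bonds starting at `y` and bonds ending at `y`
  have hsrc : (∑ b : PBond P j, w * (c ^ 2 * ((Pi.single y (1 : ℝ) : Site P j → ℝ) b.src * (G w c m2 b.tgt y - G w c m2 b.src y)))) =
      ∑ μ : Fin P.d, w * (c ^ 2 * (G w c m2 (y.shift μ) y - G w c m2 y y)) := by
    rw [sum_bond, Finset.sum_comm]
    refine Finset.sum_congr rfl fun μ _ => ?_
    rw [Finset.sum_eq_single y]
    · simp only [PBond.tgt, Pi.single_eq_same, one_mul]
    · intro x _ hx
      rw [Pi.single_eq_of_ne hx, zero_mul, mul_zero, mul_zero]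
    · intro h; exact absurd (Finset.mem_univ y) h
  have htgt : (∑ b : PBond P j, w * (c ^ 2 * ((Pi.single y (1 : ℝ) : Site P j → ℝ) b.tgt * (G w c m2 b.tgt y - G w c m2 b.src y)))) =
      ∑ μ : Fin P.d, w * (c ^ 2 * (G w c m2 y y - G w c m2 (y.unshift μ) y)) := by
    rw [sum_bond, Finset.sum_comm]
    refine Finset.sum_congr rfl fun μ _ => ?_
    -- reindex `x ↦ x + e_μ`
    have hre : (∑ x : Site P j, w * (c ^ 2 * ((Pi.single y (1 : ℝ) : Site P j → ℝ) (PBond.tgt ⟨x, μ⟩) *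
        (G w c m2 (PBond.tgt ⟨x, μ⟩) y - G w c m2 x y)))) =
        ∑ x : Site P j, w * (c ^ 2 * ((Pi.single y (1 : ℝ) : Site P j → ℝ) x * (G w c m2 x y - G w c m2 (x.unshift μ) y))) := by
      refine Fintype.sum_equiv (shiftEquiv μ) _ _ fun x => ?_
      simp only [PBond.tgt, shiftEquiv, Equiv.coe_fn_mk, unshift_shift'']
    rw [hre, Finset.sum_eq_single y]
    · rw [Pi.single_eq_same, one_mul]
    · intro x _ hx
      rw [Pi.single_eq_of_ne hx, zero_mul, mul_zero, mul_zero]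
    · intro h; exact absurd (Finset.mem_univ y) h
  have hsplit : (∑ b : PBond P j, w * (c ^ 2 * (((Pi.single y (1 : ℝ) : Site P j → ℝ) b.tgt - (Pi.single y (1 : ℝ) : Site P j → ℝ) b.src) *
      ((fun z => G w c m2 z y) b.tgt - (fun z => G w c m2 z y) b.src)))) =
      (∑ b : PBond P j, w * (c ^ 2 * ((Pi.single y (1 : ℝ) : Site P j → ℝ) b.tgt * (G w c m2 b.tgt y - G w c m2 b.src y))))
        - ∑ b : PBond P j, w * (c ^ 2 * ((Pi.single y (1 : ℝ) : Site P j → ℝ) b.src * (G w c m2 b.tgt y - G w c m2 b.src y))) := by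
    rw [← Finset.sum_sub_distrib]
    exact Finset.sum_congr rfl fun b _ => by ring
  rw [hsplit, htgt, hsrc, hmass] at h1
  -- `C₀(y − e_μ, y) = C₀(y, y + e_μ) = C₀(y + e_μ, y)`
  have hun : ∀ μ : Fin P.d, G w c m2 (y.unshift μ) y = G w c m2 (y.shift μ) y := fun μ => by
    rw [G_unshift_eq w c m2 y μ, G_symm w c m2 y (y.shift μ)]
  simp only [hun] at h1
  have hw0 : w ≠ 0 := hw.ne'
  have h2 : (∑ μ : Fin P.d, 2 * (c ^ 2 * (G w c m2 y y - G w c m2 (y.shift μ) y))) + m2 * G w c m2 y y =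
      w⁻¹ * ((∑ μ : Fin P.d, w * (c ^ 2 * (G w c m2 y y - G w c m2 (y.shift μ) y)))
        - (∑ μ : Fin P.d, w * (c ^ 2 * (G w c m2 (y.shift μ) y - G w c m2 y y))) + m2 * (w * G w c m2 y y)) := by
    rw [mul_add, mul_sub, Finset.mul_sum, Finset.mul_sum, ← Finset.sum_sub_distrib]
    congr 1
    · refine Finset.sum_congr rfl fun μ _ => ?_
      field_simp
      ring
    · field_simp
  rw [h2, h1, mul_one]

omit C μ2 in
/-- **`Σ_μ(∂^ε_μC₀)(y,y) = (ε/2)(m²C₀(y,y) − ε^{−d})`** at `cε = 1`: the forward derivatives of the free propagator at coinciding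
points, summed over the directions, are a CONTACT TERM fixed by the lattice equation. [cite: Balaban1983Higgs3, (1.21) p.416, (2.26) p.431] -/
theorem sum_d1Kernel_diag (hw : 0 < w) (hm : 0 < m2) (hcη : c * η = 1) (y : Site P j) :
    ∑ μ : Fin P.d, d1Kernel c μ (G w c m2) y y = η / 2 * (m2 * G w c m2 y y - w⁻¹) := by
  have h := latticeEq_diag w c m2 hw hm y
  have hsum : (∑ μ : Fin P.d, d1Kernel c μ (G w c m2) y y) =
      -(η / 2) * ∑ μ : Fin P.d, 2 * (c ^ 2 * (G w c m2 y y - G w c m2 (y.shift μ) y)) := by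
    rw [Finset.mul_sum]
    refine Finset.sum_congr rfl fun μ _ => ?_
    simp only [d1Kernel]
    linear_combination (c * (G w c m2 y y - G w c m2 (y.shift μ) y)) * hcη
  rw [hsum]
  linear_combination (-(η / 2)) * h

omit C in
/-- **THE (1.10)₂,₀ REMNANT OF §7 IN CLOSED FORM**: `½N·ε·e²q2·Σ_{y,μ}ε^dC^ε(y,y)(∂^ε_μC₀)(y,y) =
¼N·ε²·e²q2·Σ_yε^dC^ε(y,y)(m²C₀(y,y) − ε^{−d})` — a contact term (with the constants `C^ε(0)`, `C₀(0)` of the torus: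
`¼N ε²e²q²∣T_ε∣ε^d·C^ε(0)(m²C^ε_0(0) − ε^{−d})`). [cite: Balaban1983Higgs3, (1.10) p.413, (1.24) p.417] -/
theorem remnant_eq_contact (hw : 0 < w) (hm : 0 < m2) (hcη : c * η = 1) (Nr κ : ℝ) :
    1 / 2 * Nr * (η * κ) * ∑ y : Site P j, ∑ μ : Fin P.d, w * G w c μ2 y y * d1Kernel c μ (G w c m2) y y =
      1 / 4 * Nr * (η ^ 2 * κ) * ∑ y : Site P j, w * G w c μ2 y y * (m2 * G w c m2 y y - w⁻¹) := by
  have h : ∀ y : Site P j, (∑ μ : Fin P.d, w * G w c μ2 y y * d1Kernel c μ (G w c m2) y y) =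
      w * G w c μ2 y y * (η / 2 * (m2 * G w c m2 y y - w⁻¹)) := fun y => by
    rw [← Finset.mul_sum, sum_d1Kernel_diag η w c m2 hw hm hcη y]
  simp_rw [h]
  rw [Finset.mul_sum, Finset.mul_sum]
  exact Finset.sum_congr rfl fun y _ => by ring

end Remnant


/-! ## §9 THE ORDER-`e²` TERM OF `E₁` IN FINAL FORM: subtracted theta + `Σ₂`-theta + contact term -/

section Final

/-- **THE `(2,0)` TERM OF (1.24) WITH PRINT'S `δm²_{(2,0)}`, FINAL FORM** (§7 with the remnant evaluated by §8):
`(e²/2)·d²/de²∣₀ log∫dA dφ e^{−S^ε} = ½N·Σ_{y,y′}ε^{2d}·sig4 D(y,y′)·[C₀(y′,y) − C₀(y,y)]`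
`  + ½N·e²q2·Σ_{y,y′,μ}ε^{2d}C^ε(y,y′)(∂^ε_μC₀)(y,y′)(∂^ε_μC₀)(y′,y) + ¼N·ε²e²q2·Σ_yε^dC^ε(y,y)(m²C₀(y,y) − ε^{−d})` —
the theta in the ④-placement SUBTRACTED AT ZERO MOMENTUM, the theta in the `Σ₂`-placement, and a contact term; the `C^ε_0(0)`-
tadpole of the figure-eight and the `ct2`-bubble have cancelled.  Hypotheses as in §7 (`cε = 1`, `tr q² = N·q2`, `e²δm²_{(2,0)} =
ct2 + ct4` at every site). [cite: Balaban1983Higgs3, (1.22) p.416, (1.23)–(1.24) p.417, p.418] -/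
theorem vacuum_secondOrder_at_print_counterterm_final (hw : 0 < w) (hm : 0 < m2) (hμ : 0 < μ2) (hcη : c * η = 1)
    (e δ : ℝ) (D : SEData P j) (he : D.e = e) (hC0 : D.C0 = G w c m2) (hC : D.C = G w c μ2) (hwD : D.w = w)
    (hcD : D.c = c) (hε : D.ε ≠ 0) (htr : trE (C.q.comp C.q) = (N : ℝ) * D.q2)
    (hδ : ∀ y : Site P j, e ^ 2 * δ = ct2 D y + ct4 D y) :
    e ^ 2 / 2 * iteratedDeriv 2 (fun s => Real.log (∫ p : JCfg P j N, J C η w c (m2 + δ * s ^ 2) μ2 s p)) 0 =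
      1 / 2 * (N : ℝ) * (∑ y : Site P j, ∑ y' : Site P j, w * w * sig4 D y y' * (G w c m2 y' y - G w c m2 y y))
        + 1 / 2 * (N : ℝ) * (e ^ 2 * D.q2) *
            (∑ y : Site P j, ∑ y' : Site P j, ∑ μ : Fin P.d, w * w * G w c μ2 y y' *
              (d1Kernel c μ (G w c m2) y y' * d1Kernel c μ (G w c m2) y' y))
        + 1 / 4 * (N : ℝ) * (η ^ 2 * (e ^ 2 * D.q2)) *
            ∑ y : Site P j, w * G w c μ2 y y * (m2 * G w c m2 y y - w⁻¹) := by
  rw [vacuum_secondOrder_at_print_counterterm C η w c m2 μ2 hw hm hμ hcη e δ D he hC0 hC hwD hcD hε htr hδ,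
    remnant_eq_contact η w c m2 μ2 hw hm hcη]

end Final


/-! ## §10 (v1.1) EVERY INDEX `(α,β)` OF (1.24) WITH `α` ODD VANISHES — the joint family with the scalar self-interaction
weight `F(λ,φ)` (print: `e^{−λΣ_xε^d∣φ(x)∣⁴}`) and an `e`-even counterterm `δm² = ct(e,λ)` is even in `e` at every `λ`, so all its
odd `e`-derivatives vanish, before or after any number of (one- or two-sided) `λ`-derivatives -/

section JointParity

omit m2 in
/-- charge conjugation with a scalar observable: `∫dA dφ e^{−S^ε_{−e}}F(φ) = ∫dA dφ e^{−S^ε_e}F(φ)` at every scalar mass (private copy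
of BRICK 10's `integral_J_neg_charge` at a general mass `M`). [cite: Balaban1983Higgs3, (1.19)–(1.20) p.416] -/
private theorem integral_J_neg_charge_F (M e : ℝ) (F : Cfg P j N → ℝ) :
    ∫ p : JCfg P j N, J C η w c M μ2 (-e) p * F p.2 = ∫ p : JCfg P j N, J C η w c M μ2 e p * F p.2 := by
  simp_rw [J_neg_charge C η w c M μ2 e]
  exact integral_comp_negVec' (fun p => J C η w c M μ2 e p * F p.2)

/-- **THE JOINT PARTITION FUNCTION OF (1.24) IS EVEN IN THE CHARGE AT EVERY `λ`**: for an `e`-even counterterm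
`ct(−e,λ) = ct(e,λ)` and ANY weight `F(λ,·)` of the scalar field alone (print's `e^{−λΣ_xε^d∣φ(x)∣⁴}` of (1.20)),
`∫dA dφ J_{−e}(m²+ct(−e,λ))F(λ,φ) = ∫dA dφ J_e(m²+ct(e,λ))F(λ,φ)` (the reflection `A ↦ −A`). [cite: Balaban1983Higgs3, (1.19)–(1.20) p.416, (1.24) p.417] -/
theorem Z_joint_neg_charge {ct : ℝ → ℝ → ℝ} (hct : ∀ e l, ct (-e) l = ct e l) (F : ℝ → Cfg P j N → ℝ) (e l : ℝ) :
    ∫ p : JCfg P j N, J C η w c (m2 + ct (-e) l) μ2 (-e) p * F l p.2 =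
      ∫ p : JCfg P j N, J C η w c (m2 + ct e l) μ2 e p * F l p.2 := by
  rw [hct]
  exact integral_J_neg_charge_F C η w c μ2 (m2 + ct e l) e (F l)

/-- **EVERY TERM `(α,β)` OF (1.24) WITH `α` ODD VANISHES** (all `β`; the `λ`-derivatives taken within any set `s` at any
point `l₀` — in particular print's right derivatives at `λ = 0⁺`, `s = [0,∞)`, as r01's `e1R` reads them — or two-sided):
`∂^{2k+1}_e[∂^β_λ log∫dA dφ e^{−S^ε_{e,λ}}]∣_{e=0} = 0` for the action (1.20) with the quartic weight `F(λ,φ)` and an `e`-even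
counterterm `ct(e,λ)` inserted.  With (1.23) (`δm²_{(3,0)} = δm²_{(1,1)} = 0`, all listed `α` even) the inserted counterterm is
`e`-even, so of the range `2 ≤ α+2β ≤ 6` that p. 418 says *"it is sufficient to take"*, the indices `(3,0)`, `(1,1)`, `(5,0)`,
`(3,1)`, `(1,2)` contribute nothing: `E₁` through weight 6 consists of `(2,0)` (this file), `(0,1)`, `(4,0)`, `(2,1)`, `(0,2)`,
`(6,0)`, `(4,1)`, `(2,2)`, `(0,3)`.  (Pure symmetry: no differentiability is needed for the statement in Mathlib's total
`iteratedDeriv`/`iteratedDerivWithin`.) [cite: Balaban1983Higgs3, (1.23)–(1.24) p.417, p.418] -/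
theorem iteratedDeriv_odd_logZ_joint {ct : ℝ → ℝ → ℝ} (hct : ∀ e l, ct (-e) l = ct e l) (F : ℝ → Cfg P j N → ℝ)
    (β k : ℕ) (s : Set ℝ) (l₀ : ℝ) :
    iteratedDeriv (2 * k + 1) (fun e => iteratedDerivWithin β
      (fun l => Real.log (∫ p : JCfg P j N, J C η w c (m2 + ct e l) μ2 e p * F l p.2)) s l₀) 0 = 0 := by
  refine iteratedDeriv_odd_eq_zero_of_even' (fun e => ?_) k
  have hfun : (fun l => Real.log (∫ p : JCfg P j N, J C η w c (m2 + ct (-e) l) μ2 (-e) p * F l p.2)) =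
      fun l => Real.log (∫ p : JCfg P j N, J C η w c (m2 + ct e l) μ2 e p * F l p.2) := by
    funext l
    rw [Z_joint_neg_charge C η w c m2 μ2 hct F e l]
  simp only [hfun]

/-- the same with two-sided `λ`-derivatives (r15's `E1of124` reading). [cite: Balaban1983Higgs3, (1.24) p.417] -/
theorem iteratedDeriv_odd_logZ_joint' {ct : ℝ → ℝ → ℝ} (hct : ∀ e l, ct (-e) l = ct e l) (F : ℝ → Cfg P j N → ℝ)
    (β k : ℕ) (l₀ : ℝ) :
    iteratedDeriv (2 * k + 1) (fun e => iteratedDeriv β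
      (fun l => Real.log (∫ p : JCfg P j N, J C η w c (m2 + ct e l) μ2 e p * F l p.2)) l₀) 0 = 0 := by
  refine iteratedDeriv_odd_eq_zero_of_even' (fun e => ?_) k
  have hfun : (fun l => Real.log (∫ p : JCfg P j N, J C η w c (m2 + ct (-e) l) μ2 (-e) p * F l p.2)) =
      fun l => Real.log (∫ p : JCfg P j N, J C η w c (m2 + ct e l) μ2 e p * F l p.2) := by
    funext l
    rw [Z_joint_neg_charge C η w c m2 μ2 hct F e l]
  simp only [hfun]

/-- **PRINT'S INDEX `(1,1)` OF (1.24) VANISHES** (the instance `k = 0`, `β = 1`, right derivative at `λ = 0⁺`):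
`∂_e[∂_λ^+ log Z^ε(e,λ)∣_{λ=0}]∣_{e=0} = 0`. [cite: Balaban1983Higgs3, (1.24) p.417] -/
theorem index_one_one_logZ_joint {ct : ℝ → ℝ → ℝ} (hct : ∀ e l, ct (-e) l = ct e l) (F : ℝ → Cfg P j N → ℝ) :
    iteratedDeriv 1 (fun e => iteratedDerivWithin 1
      (fun l => Real.log (∫ p : JCfg P j N, J C η w c (m2 + ct e l) μ2 e p * F l p.2)) (Set.Ici 0) 0) 0 = 0 :=
  iteratedDeriv_odd_logZ_joint C η w c m2 μ2 hct F 1 0 (Set.Ici 0) 0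

/-- **WITH PRINT'S (1.20) INTERACTION LITERALLY**: for the quartic self-interaction weight `e^{−λΣ_xε^d∣φ(x)∣⁴}` of (1.20) and
an `e`-even counterterm `ct(e,λ)`, `∂^{2k+1}_e[(∂^+_λ)^β log∫dA dφ e^{−S^ε_{e,λ}}∣_{λ=0⁺}]∣_{e=0} = 0` for every `β`, `k` (the
instance `F(λ,φ) = exp(−λΣ_yε^d‖φ(y)‖⁴)` of `iteratedDeriv_odd_logZ_joint`, right `λ`-derivatives at `0⁺`).
[cite: Balaban1983Higgs3, (1.20) p.416, (1.24) p.417] -/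
theorem iteratedDeriv_odd_logZ_quartic {ct : ℝ → ℝ → ℝ} (hct : ∀ e l, ct (-e) l = ct e l) (β k : ℕ) :
    iteratedDeriv (2 * k + 1) (fun e => iteratedDerivWithin β
      (fun l => Real.log (∫ p : JCfg P j N, J C η w c (m2 + ct e l) μ2 e p *
        Real.exp (-(l * ∑ y : Site P j, w * ‖p.2 y‖ ^ 4)))) (Set.Ici 0) 0) 0 = 0 :=
  iteratedDeriv_odd_logZ_joint C η w c m2 μ2 hct
    (fun l φ => Real.exp (-(l * ∑ y : Site P j, w * ‖φ y‖ ^ 4))) β k (Set.Ici 0) 0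

/-- the same with two-sided `λ`-derivatives at `λ = 0` (r15's `E1of124` reading of (1.24)).
[cite: Balaban1983Higgs3, (1.20) p.416, (1.24) p.417] -/
theorem iteratedDeriv_odd_logZ_quartic' {ct : ℝ → ℝ → ℝ} (hct : ∀ e l, ct (-e) l = ct e l) (β k : ℕ) :
    iteratedDeriv (2 * k + 1) (fun e => iteratedDeriv β
      (fun l => Real.log (∫ p : JCfg P j N, J C η w c (m2 + ct e l) μ2 e p *
        Real.exp (-(l * ∑ y : Site P j, w * ‖p.2 y‖ ^ 4)))) 0) 0 = 0 :=
  iteratedDeriv_odd_logZ_joint' C η w c m2 μ2 hct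
    (fun l φ => Real.exp (-(l * ∑ y : Site P j, w * ‖φ y‖ ^ 4))) β k 0

end JointParity

/-! ## §11 (v1.1) `E₁` IS EXTENSIVE: the order-`e²` vacuum term is `∣T_ε∣` times a density independent of the base point (every
kernel involved — `C^ε`, `C₀` and their lattice derivatives — is translation invariant on the torus; contrast p. 418: only after
the replacement `C^ε ↦ G^ε_K` *"the propagators … are not translation invariant, so we have the dependence on x"*) -/

section Extensive

omit C η μ2 in
/-- `(∂^ε_μC₀)` is translation invariant: `d1Kernel c μ C₀ (y+t) (y′+t) = d1Kernel c μ C₀ y y′`. [cite: Balaban1983Higgs3, (2.26) p.431] -/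
theorem d1Kernel_transl (μ : Fin P.d) (t y y' : Site P j) :
    d1Kernel c μ (G w c m2) (transl t y) (transl t y') = d1Kernel c μ (G w c m2) y y' := by
  simp only [d1Kernel, transl_shift, G_transl]

omit C η μ2 in
/-- `(∂^ε_μC₀∂^{ε*}_μ)` is translation invariant. [cite: Balaban1983Higgs3, (2.26) p.431] -/
theorem dKernel_transl (μ : Fin P.d) (t y y' : Site P j) :
    dKernel c μ (G w c m2) (transl t y) (transl t y') = dKernel c μ (G w c m2) y y' := by
  simp only [dKernel, transl_shift, G_transl]

omit C η w c m2 μ2 in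
/-- a translation-invariant summand sums to `∣T∣` times its value at a base point: if `f(y+t) = f(y)` for all `t`, then
`Σ_y f(y) = ∣T∣·f(y₀)`. [folklore] -/
private theorem sum_eq_card_mul_of_transl {f : Site P j → ℝ} (hf : ∀ t y, f (transl t y) = f y) (y₀ : Site P j) :
    ∑ y : Site P j, f y = (Fintype.card (Site P j) : ℝ) * f y₀ := by
  have h : ∀ y : Site P j, f y = f y₀ := fun y => by
    have := hf (fun μ => y μ - y₀ μ) y₀
    have hx : transl (fun μ => y μ - y₀ μ) y₀ = y := by funext μ; simp [transl]
    rw [hx] at this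
    exact this
  rw [Finset.sum_congr rfl fun y _ => h y, Finset.sum_const, Finset.card_univ, nsmul_eq_mul]

omit C η w c m2 μ2 in
/-- a sum over the torus is invariant under translating the summation variable. [folklore] -/
private theorem sum_transl (t : Site P j) (g : Site P j → ℝ) : ∑ y' : Site P j, g (transl t y') = ∑ y' : Site P j, g y' :=
  Fintype.sum_equiv (translEquiv t) _ _ fun _ => rfl

/-- **THE ORDER-`e²` TERM OF (1.24) IS EXTENSIVE**: `d²/de²∣₀ log∫dA dφ e^{−S^ε_e} = ∣T_ε∣·𝔢(y₀)` with the DENSITY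
`𝔢(y₀) = tr(q²)·[Σ_μη^dC^ε(y₀,y₀)C₀(y₀,y₀+εe_μ) + Σ_{y′,μ}η^{2d}C^ε(y₀,y′)((∂_μC₀)(y₀,y′)(∂_μC₀)(y′,y₀) − C₀(y₀,y′)(∂_μC₀∂*_μ)(y₀,y′))]
− (ct″(0)/2)·N·η^dC₀(y₀,y₀)`, the same number at every base point `y₀` (translation invariance of `C^ε`, `C₀`, `∂^ε_μC₀`,
`∂^ε_μC₀∂^{ε*}_μ` on the torus — this seat's `B3WTCovariance.G_transl`); `∣T_ε∣ = Fintype.card` of the sites.  B1's Theorem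
(`exp(−E₋∣T_ε∣) ≤ Z^ε ≤ exp(E₊∣T_ε∣)`) and (1.4)'s `E_±(…)` are stated per unit `∣T_ε∣` in this sense.
[cite: Balaban1983Higgs3, (1.24) p.417, p.418] [cite: Balaban1982Higgs1, Theorem (1.14) p.606] -/
theorem iteratedDeriv_two_logZ_curve_eq_card_mul (hw : 0 < w) (hm : 0 < m2) (hμ : 0 < μ2) (hcη : c * η = 1)
    {ct ct' ct'' : ℝ → ℝ} (hd : ∀ e, HasDerivAt ct (ct' e) e) (hd' : ∀ e, HasDerivAt ct' (ct'' e) e)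
    (hc'' : ContinuousAt ct'' 0) (h0 : ct 0 = 0) (h0' : ct' 0 = 0) (y₀ : Site P j) :
    iteratedDeriv 2 (fun e => Real.log (∫ p : JCfg P j N, J C η w c (m2 + ct e) μ2 e p)) 0 =
      (Fintype.card (Site P j) : ℝ) *
        (trE (C.q.comp C.q) *
            ((∑ μ : Fin P.d, w * G w c μ2 y₀ y₀ * G w c m2 y₀ (y₀.shift μ))
              + ∑ y' : Site P j, ∑ μ : Fin P.d, w * w * G w c μ2 y₀ y' *
                  (d1Kernel c μ (G w c m2) y₀ y' * d1Kernel c μ (G w c m2) y' y₀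
                    - G w c m2 y₀ y' * dKernel c μ (G w c m2) y₀ y'))
          - ct'' 0 / 2 * ((N : ℝ) * (w * G w c m2 y₀ y₀))) := by
  rw [iteratedDeriv_two_logZ_curve_eq_lattice C η w c m2 μ2 hw hm hμ hcη hd hd' hc'' h0 h0']
  -- each of the three sums over `y` has a translation-invariant summand
  have h1 : (∑ y : Site P j, ∑ μ : Fin P.d, w * G w c μ2 y y * G w c m2 y (y.shift μ)) =
      (Fintype.card (Site P j) : ℝ) * ∑ μ : Fin P.d, w * G w c μ2 y₀ y₀ * G w c m2 y₀ (y₀.shift μ) := by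
    refine sum_eq_card_mul_of_transl (fun t y => ?_) y₀
    refine Finset.sum_congr rfl fun μ _ => ?_
    rw [transl_shift, G_transl, G_transl]
  have h2 : (∑ y : Site P j, ∑ y' : Site P j, ∑ μ : Fin P.d, w * w * G w c μ2 y y' *
      (d1Kernel c μ (G w c m2) y y' * d1Kernel c μ (G w c m2) y' y - G w c m2 y y' * dKernel c μ (G w c m2) y y')) =
      (Fintype.card (Site P j) : ℝ) * ∑ y' : Site P j, ∑ μ : Fin P.d, w * w * G w c μ2 y₀ y' *
        (d1Kernel c μ (G w c m2) y₀ y' * d1Kernel c μ (G w c m2) y' y₀ - G w c m2 y₀ y' * dKernel c μ (G w c m2) y₀ y') := by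
    refine sum_eq_card_mul_of_transl (fun t y => ?_) y₀
    rw [← sum_transl t (fun y' => ∑ μ : Fin P.d, w * w * G w c μ2 (transl t y) y' *
      (d1Kernel c μ (G w c m2) (transl t y) y' * d1Kernel c μ (G w c m2) y' (transl t y)
        - G w c m2 (transl t y) y' * dKernel c μ (G w c m2) (transl t y) y'))]
    refine Finset.sum_congr rfl fun y' _ => Finset.sum_congr rfl fun μ _ => ?_
    rw [G_transl, G_transl, d1Kernel_transl, d1Kernel_transl, dKernel_transl]
  have h3 : (∑ x : Site P j, w * G w c m2 x x) = (Fintype.card (Site P j) : ℝ) * (w * G w c m2 y₀ y₀) := by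
    refine sum_eq_card_mul_of_transl (fun t y => ?_) y₀
    rw [G_transl]
  rw [h1, h2, h3]
  ring

end Extensive


/-! ## §12 (v1.1) PRINT'S `δm²_{(2,0)}` IS A NUMBER on this carrier: the hypothesis «`e²δ = ct2 D y + ct4 D y` at every site» of
§7/§9 is satisfiable — for the torus propagators `C₀`, `C^ε` the counterterms ②, ④ of (1.23) do not depend on the site (translation
invariance; p26 `B3Eq123Counterterms.ct2_const`/`ct4_const` prove this under the abstract `ShiftInv` hypothesis, here it is
unconditional for `D.C0 = C₀`, `D.C = C^ε`) -/

section PrintDelta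

/-- **`ct2 D + ct4 D` IS CONSTANT ON THE TORUS** for p26's (1.22)/(1.23)-data carrying the torus propagators (`D.C0 = C₀`,
`D.C = C^ε`, `D.w = η^d`, `D.c = c`): `ct2 D y + ct4 D y = ct2 D y₀ + ct4 D y₀` — print's `δm²` of (1.23) is a number (all its
propagators are functions of `x − x′`). [cite: Balaban1983Higgs3, (1.23) p.417] -/
theorem ct2_add_ct4_const (D : SEData P j) (hC0 : D.C0 = G w c m2) (hC : D.C = G w c μ2) (hwD : D.w = w) (hcD : D.c = c)
    (hε : D.ε ≠ 0) (y y₀ : Site P j) : ct2 D y + ct4 D y = ct2 D y₀ + ct4 D y₀ := by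
  have h2 : ct2 D y = ct2 D y₀ := by
    rw [ct2_eq D hε y, ct2_eq D hε y₀, hC, G_diag_const w c μ2 y y₀]
  have h4 : ∀ z : Site P j, ct4 D z = -(D.e ^ 2) * ∑ y' : Site P j, w * ∑ μ : Fin P.d,
      D.q2 * dKernel c μ (G w c m2) z y' * G w c μ2 z y' := fun z => by
    rw [ct4_eq D z, hC0, hC, hwD, hcD]
  have h4' : ct4 D y = ct4 D y₀ := by
    rw [h4, h4]
    congr 1
    -- translate the summation variable by `y − y₀`
    set t : Site P j := fun μ => y μ - y₀ μ with ht
    have hy : transl t y₀ = y := by funext μ; simp [transl, ht]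
    rw [← hy, ← sum_transl t (fun y' => w * ∑ μ : Fin P.d, D.q2 * dKernel c μ (G w c m2) (transl t y₀) y' *
      G w c μ2 (transl t y₀) y')]
    refine Finset.sum_congr rfl fun y' _ => ?_
    simp only [dKernel_transl, G_transl]
  rw [h2, h4']

/-- **PRINT'S `δm²_{(2,0)}` EXPLICITLY**: with `D.e = e` and the torus propagators,
`e²·[d·C^ε(0)·q2 − Σ_{x′}ε^dΣ_μ q2(∂^ε_μC₀∂^{ε*}_μ)(y₀,x′)C^ε(y₀,x′)] = ct2 D y + ct4 D y` at EVERY site `y` (any base point `y₀`):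
the bracket is the coefficient `δm²_{(2,0)} = ②/e² + ④/e²` of (1.23). [cite: Balaban1983Higgs3, (1.23) p.417] -/
theorem print_delta20_eq (e : ℝ) (D : SEData P j) (he : D.e = e) (hC0 : D.C0 = G w c m2) (hC : D.C = G w c μ2)
    (hwD : D.w = w) (hcD : D.c = c) (hε : D.ε ≠ 0) (y y₀ : Site P j) :
    e ^ 2 * ((P.d : ℝ) * G w c μ2 y₀ y₀ * D.q2
      - ∑ x' : Site P j, w * ∑ μ : Fin P.d, D.q2 * dKernel c μ (G w c m2) y₀ x' * G w c μ2 y₀ x') =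
      ct2 D y + ct4 D y := by
  rw [ct2_add_ct4_const w c m2 μ2 D hC0 hC hwD hcD hε y y₀, ct2_eq D hε y₀, ct4_eq D y₀, hC, hC0, hwD, hcD, he]
  ring

/-- **THE HYPOTHESIS `hδ` OF §7/§9 IS SATISFIABLE**: with `D.e = e` there is a number `δ` (print's `δm²_{(2,0)}`, §12
`print_delta20_eq`) with `e²δ = ct2 D y + ct4 D y` at EVERY site `y`. [cite: Balaban1983Higgs3, (1.23) p.417] -/
theorem exists_print_delta20 (e : ℝ) (D : SEData P j) (he : D.e = e) (hC0 : D.C0 = G w c m2) (hC : D.C = G w c μ2)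
    (hwD : D.w = w) (hcD : D.c = c) (hε : D.ε ≠ 0) :
    ∃ δ : ℝ, ∀ y : Site P j, e ^ 2 * δ = ct2 D y + ct4 D y :=
  ⟨_, fun y => print_delta20_eq w c m2 μ2 e D he hC0 hC hwD hcD hε y default⟩

end PrintDelta

/-! ## §13 (v1.1) THE RENORMALIZED ORDER-`e²` VACUUM TERM IS EXTENSIVE: §9's value is `∣T_ε∣` times an explicit density (every
kernel of §9 — `C^ε`, `C₀`, `∂^ε_μC₀`, `Σ₄` — is translation invariant on the torus) -/

section FinalExtensive

omit C η in
/-- `Σ₄` of (1.22) built from the torus propagators (`D.C0 = C₀`, `D.C = C^ε`, `D.c = c`) is translation invariant: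
`Σ₄(y+t,y′+t) = Σ₄(y,y′)`. [cite: Balaban1983Higgs3, (1.22) p.416, (2.26) p.431] -/
theorem sig4_transl (D : SEData P j) (hC0 : D.C0 = G w c m2) (hC : D.C = G w c μ2) (hcD : D.c = c) (t y y' : Site P j) :
    sig4 D (transl t y) (transl t y') = sig4 D y y' := by
  simp only [sig4, hC0, hC, hcD, dKernel_transl, G_transl]

/-- **THE RENORMALIZED `(2,0)` TERM OF (1.24) IS `∣T_ε∣` TIMES A DENSITY** (§9 at a base point `y₀`):
`(e²/2)·d²/ds²∣₀ log∫dA dφ e^{−S^ε} = ∣T_ε∣·[½N·Σ_{y′}ε^{2d}Σ₄(y₀,y′)(C₀(y′,y₀) − C₀(y₀,y₀))`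
`  + ½N·e²q2·Σ_{y′,μ}ε^{2d}C^ε(y₀,y′)(∂^ε_μC₀)(y₀,y′)(∂^ε_μC₀)(y′,y₀) + ¼N·ε²e²q2·ε^dC^ε(y₀,y₀)(m²C₀(y₀,y₀) − ε^{−d})]`,
the bracket independent of `y₀` (translation invariance of `C^ε`, `C₀`, `∂^ε_μC₀`, `Σ₄`); `∣T_ε∣ = Fintype.card` of the sites.
This is the per-volume normalization (`E_±∣T_ε∣`) in which B1's Theorem (`exp(−E₋∣T_ε∣) ≤ Z^ε ≤ exp(E₊∣T_ε∣)`) is stated;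
nothing is claimed about the size of the bracket.  Hypotheses as in §7/§9. [cite: Balaban1983Higgs3, (1.22)–(1.24) pp.416–417, p.418] [cite: Balaban1982Higgs1, Theorem (1.14) p.606] -/
theorem vacuum_secondOrder_at_print_counterterm_density (hw : 0 < w) (hm : 0 < m2) (hμ : 0 < μ2) (hcη : c * η = 1)
    (e δ : ℝ) (D : SEData P j) (he : D.e = e) (hC0 : D.C0 = G w c m2) (hC : D.C = G w c μ2) (hwD : D.w = w)
    (hcD : D.c = c) (hε : D.ε ≠ 0) (htr : trE (C.q.comp C.q) = (N : ℝ) * D.q2)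
    (hδ : ∀ y : Site P j, e ^ 2 * δ = ct2 D y + ct4 D y) (y₀ : Site P j) :
    e ^ 2 / 2 * iteratedDeriv 2 (fun s => Real.log (∫ p : JCfg P j N, J C η w c (m2 + δ * s ^ 2) μ2 s p)) 0 =
      (Fintype.card (Site P j) : ℝ) *
        (1 / 2 * (N : ℝ) * (∑ y' : Site P j, w * w * sig4 D y₀ y' * (G w c m2 y' y₀ - G w c m2 y₀ y₀))
          + 1 / 2 * (N : ℝ) * (e ^ 2 * D.q2) *
              (∑ y' : Site P j, ∑ μ : Fin P.d, w * w * G w c μ2 y₀ y' *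
                (d1Kernel c μ (G w c m2) y₀ y' * d1Kernel c μ (G w c m2) y' y₀))
          + 1 / 4 * (N : ℝ) * (η ^ 2 * (e ^ 2 * D.q2)) * (w * G w c μ2 y₀ y₀ * (m2 * G w c m2 y₀ y₀ - w⁻¹))) := by
  rw [vacuum_secondOrder_at_print_counterterm_final C η w c m2 μ2 hw hm hμ hcη e δ D he hC0 hC hwD hcD hε htr hδ]
  -- each of the three sums over `y` has a translation-invariant summand
  have h1 : (∑ y : Site P j, ∑ y' : Site P j, w * w * sig4 D y y' * (G w c m2 y' y - G w c m2 y y)) =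
      (Fintype.card (Site P j) : ℝ) *
        ∑ y' : Site P j, w * w * sig4 D y₀ y' * (G w c m2 y' y₀ - G w c m2 y₀ y₀) := by
    refine sum_eq_card_mul_of_transl (fun t y => ?_) y₀
    rw [← sum_transl t (fun y' => w * w * sig4 D (transl t y) y' *
      (G w c m2 y' (transl t y) - G w c m2 (transl t y) (transl t y)))]
    refine Finset.sum_congr rfl fun y' _ => ?_
    rw [sig4_transl w c m2 μ2 D hC0 hC hcD, G_transl, G_transl]
  have h2 : (∑ y : Site P j, ∑ y' : Site P j, ∑ μ : Fin P.d, w * w * G w c μ2 y y' *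
      (d1Kernel c μ (G w c m2) y y' * d1Kernel c μ (G w c m2) y' y)) =
      (Fintype.card (Site P j) : ℝ) * ∑ y' : Site P j, ∑ μ : Fin P.d, w * w * G w c μ2 y₀ y' *
        (d1Kernel c μ (G w c m2) y₀ y' * d1Kernel c μ (G w c m2) y' y₀) := by
    refine sum_eq_card_mul_of_transl (fun t y => ?_) y₀
    rw [← sum_transl t (fun y' => ∑ μ : Fin P.d, w * w * G w c μ2 (transl t y) y' *
      (d1Kernel c μ (G w c m2) (transl t y) y' * d1Kernel c μ (G w c m2) y' (transl t y)))]
    refine Finset.sum_congr rfl fun y' _ => Finset.sum_congr rfl fun μ _ => ?_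
    rw [G_transl, d1Kernel_transl, d1Kernel_transl]
  have h3 : (∑ y : Site P j, w * G w c μ2 y y * (m2 * G w c m2 y y - w⁻¹)) =
      (Fintype.card (Site P j) : ℝ) * (w * G w c μ2 y₀ y₀ * (m2 * G w c m2 y₀ y₀ - w⁻¹)) := by
    refine sum_eq_card_mul_of_transl (fun t y => ?_) y₀
    rw [G_transl, G_transl]
  rw [h1, h2, h3]
  ring

end FinalExtensive

/-! ## §14 (v1.1) THE RENORMALIZED ORDER-`e²` VACUUM TERM, CARRIER-FREE: print's `δm²_{(2,0)}` (§12) inserted as the number it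
is, the value written in the torus propagators `C₀`, `C^ε` alone — no `SEData`, no hypothesis `hδ` -/

section Explicit

/-- **THE `(2,0)` TERM OF (1.24) WITH PRINT'S `δm²_{(2,0)}`, EXPLICIT FORM**: for the site weight `η^d`, `cη = 1`,
`tr q² = N·q2`, and the counterterm curve `δm²(s) = δm²_{(2,0)}·s²` with print's number
`δm²_{(2,0)} = d·C^ε(0)·q2 − Σ_{x′}η^dΣ_μq2(∂^η_μC₀∂^{η*}_μ)(y₀,x′)C^ε(y₀,x′)` ((1.23) ② + ④ per `e²`, §12),
`(e²/2)·d²/ds²∣₀ log∫dA dφ e^{−S^η_s} = ∣T∣·[−½N e²q2·Σ_{y′,μ}η^{2d}(∂_μC₀∂*_μ)(y₀,y′)C^ε(y₀,y′)(C₀(y′,y₀) − C₀(y₀,y₀))`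
`  + ½N e²q2·Σ_{y′,μ}η^{2d}C^ε(y₀,y′)(∂_μC₀)(y₀,y′)(∂_μC₀)(y′,y₀) + ¼N η²e²q2·η^dC^ε(y₀,y₀)(m²C₀(y₀,y₀) − η^{−d})]` —
§13 with p26's letters `D = ⟨η, e, 0, N, q2, C₀, C^ε⟩` eliminated. [cite: Balaban1983Higgs3, (1.22)–(1.24) pp.416–417, p.418] -/
theorem vacuum_secondOrder_explicit (hw : 0 < w) (hm : 0 < m2) (hμ : 0 < μ2) (hcη : c * η = 1) (hwη : w = η ^ P.d)
    (q2 : ℝ) (htr : trE (C.q.comp C.q) = (N : ℝ) * q2) (e : ℝ) (y₀ : Site P j) :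
    e ^ 2 / 2 * iteratedDeriv 2 (fun s => Real.log (∫ p : JCfg P j N,
      J C η w c (m2 + ((P.d : ℝ) * G w c μ2 y₀ y₀ * q2
        - ∑ x' : Site P j, w * ∑ μ : Fin P.d, q2 * dKernel c μ (G w c m2) y₀ x' * G w c μ2 y₀ x') * s ^ 2) μ2 s p)) 0 =
      (Fintype.card (Site P j) : ℝ) *
        (-(1 / 2 * (N : ℝ) * (e ^ 2 * q2)) *
            (∑ y' : Site P j, ∑ μ : Fin P.d, w * w * dKernel c μ (G w c m2) y₀ y' * G w c μ2 y₀ y' *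
              (G w c m2 y' y₀ - G w c m2 y₀ y₀))
          + 1 / 2 * (N : ℝ) * (e ^ 2 * q2) *
              (∑ y' : Site P j, ∑ μ : Fin P.d, w * w * G w c μ2 y₀ y' *
                (d1Kernel c μ (G w c m2) y₀ y' * d1Kernel c μ (G w c m2) y' y₀))
          + 1 / 4 * (N : ℝ) * (η ^ 2 * (e ^ 2 * q2)) * (w * G w c μ2 y₀ y₀ * (m2 * G w c m2 y₀ y₀ - w⁻¹))) := by
  have hη : η ≠ 0 := by
    rintro rfl
    rw [mul_zero] at hcη
    exact zero_ne_one hcη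
  have hcη' : c = η⁻¹ := eq_inv_of_mul_eq_one_left hcη
  -- p26's letters carrying the torus propagators
  let D0 : SEData P j := ⟨η, e, 0, N, q2, G w c m2, G w c μ2⟩
  have hwD : D0.w = w := by rw [hwη]; rfl
  have hcD : D0.c = c := by rw [hcη']; rfl
  have hδ : ∀ y : Site P j, e ^ 2 * ((P.d : ℝ) * G w c μ2 y₀ y₀ * q2
      - ∑ x' : Site P j, w * ∑ μ : Fin P.d, q2 * dKernel c μ (G w c m2) y₀ x' * G w c μ2 y₀ x') =
      ct2 D0 y + ct4 D0 y := fun y =>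
    print_delta20_eq w c m2 μ2 e D0 rfl rfl rfl hwD hcD hη y y₀
  rw [vacuum_secondOrder_at_print_counterterm_density C η w c m2 μ2 hw hm hμ hcη e _ D0 rfl rfl rfl hwD hcD hη htr hδ y₀]
  -- unfold `Σ₄` of the letters
  have hq : D0.q2 = q2 := rfl
  have hs4 : ∀ y' : Site P j, sig4 D0 y₀ y' =
      -(e ^ 2) * ∑ μ : Fin P.d, q2 * dKernel c μ (G w c m2) y₀ y' * G w c μ2 y₀ y' := fun y' => by
    show -(e ^ 2) * ∑ μ : Fin P.d, q2 * dKernel D0.c μ (G w c m2) y₀ y' * G w c μ2 y₀ y' = _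
    rw [hcD]
  have h1 : 1 / 2 * (N : ℝ) * (∑ y' : Site P j, w * w * sig4 D0 y₀ y' * (G w c m2 y' y₀ - G w c m2 y₀ y₀)) =
      -(1 / 2 * (N : ℝ) * (e ^ 2 * q2)) *
        ∑ y' : Site P j, ∑ μ : Fin P.d, w * w * dKernel c μ (G w c m2) y₀ y' * G w c μ2 y₀ y' *
          (G w c m2 y' y₀ - G w c m2 y₀ y₀) := by
    rw [Finset.mul_sum, Finset.mul_sum]
    refine Finset.sum_congr rfl fun y' _ => ?_
    rw [hs4 y', Finset.mul_sum, Finset.mul_sum]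
    simp only [Finset.sum_mul, Finset.mul_sum]
    refine Finset.sum_congr rfl fun μ _ => ?_
    ring
  rw [h1, hq]

end Explicit

end Literature.MathematicalPhysics.QuantumFieldTheory.Balaban1983to89.B3Eq124VacuumChargeWick

end
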